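import Literature.MathematicalPhysics.QuantumFieldTheory.Balaban1983to89.Beta.AveragingThirdJet
import Literature.MathematicalPhysics.QuantumFieldTheory.Balaban1983to89.Beta.AveragingHessianKernelsRooted

/-!
# Bałaban β-cell, node 12b (an1): the ROOTED group-level averaging jets and the SECOND-ORDER TABLES
# `mixFFAt` / `vh₂SAt` consumed by the background-field route's (P4)

HONEST FRAMING (page 1 of everything in this cell). Discharging `BetaPertH` makes Bałaban's ultraviolet stability
UNCONDITIONAL — a real constructive-QFT result; it is NOT the continuum limit and NOT the Clay problem. This module
discharges nothing: it is LETTER ALGEBRA in the truncated formal calculus of node 12 (`AveragingThirdJet`), rooted at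
an arbitrary offset `ρ` as in nodes 5ρ/7aρ (`AveragingContoursRooted`, `AveragingHessianKernelsRooted`).

ABSOLUTE RULE. No internally-minted statement may enter as a cited fact. Every hypothesis is either kernel-proved in
this package or a verbatim quotation of a PUBLISHED theorem with page reference. The manuscript(s) under audit are NOT
citable for their own disputed steps — they are the thing under adjudication; programme-internal (2001/route/tribunal)
claims are never citable. Accordingly EVERYTHING below is tagged [folklore]: definitions by explicit formula and
theorems proved from them; NO published statement is asserted, and the numerical VALUES of the tables (certified
outside Lean by two independent engines, an1 `engine_m2.py` ↔ lit3 `diff_m2_an1.py`, 28/28 word-for-word) are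
provenance remarks in docstrings, never hypotheses.

## What is here

* §1 letters: every letter of a rooted contour list is an oriented bond (any root); the LETTER SHIFT homomorphism and
  the transport of holonomies under it; CONGRUENCE of holonomies (transporters agreeing on the letters).
* §2 `PhiGAt ρ` — node 12's one-step covariant averaging (15)/(42) `PhiG` on group-valued transporters, over the ROOTED
  lists `loopCAt ρ δ` and the straight coarse bond from the root `L·y + ρ`; bridge `PhiGAt 0 = PhiG`; naturality,
  triviality, congruence, BLOCK TRANSLATION `Φ^ρ_{(μ, y+v)}(G) = Φ^ρ_{(μ,y)}(G(· + L v))`.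
* §3 `QjetAt ρ` — node 12's averaged jet `Qjet` verbatim over `PhiGAt` (bridge `QjetAt 0 = Qjet`), and the SYMMETRISED
  second-order background response `T2At ρ ω B B′ := c11 (QjetAt ρ ω B B′) + c11 (QjetAt ρ ω B′ B)` (symmetric in
  `(B, B′)` by construction).
* §4 the MIXED chart (fluctuation pair LEFT, in ONE symmetric exponential; background right):
  `U_f = e^{τ₁ W_f + τ₂ V_f} · e^{σ B_f}` in `Rho 𝔸` (`τ₁, τ₂` the inner parameters of `Tau 𝔸`, `σ` the outer one),
  `Zf W V = expT (τ₁ W + τ₂ V) = 1 + τ₁ W + τ₂ V + ½ τ₁τ₂ (WV + VW)` (symmetric in `W ↔ V`; `Zb` = the letter with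
  negated linear parts, its inverse away from characteristic `2` — a fact neither used nor proved here), the
  right-trivialised MIXED JET `MjetAt ρ W V B L μ y := c11 ((logT (Φ(U) · invT Φ(E))).snd) ∈ 𝔸` — the
  `τ₁τ₂σ`-coefficient of `log[Φ_b(U) Φ_b(E)⁻¹]`, `E = e^{σB}`; VANISHING when one of the three slots is `0`
  (kill homomorphisms), naturality, block translation, congruence.
* §5 SCALAR TABLES by WORD-COEFFICIENT EXTRACTION in the path algebra `Matrix (Fin 4) (Fin 4) ℚ`: a letter placed on
  the matrix unit `E_{i,i+1}` at a single bond and `0` elsewhere makes the `(0,3)` entry of a trilinear jet the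
  coefficient of ONE word; `aTab` (word `W_f V_{f′} B_g`), `apTab` (word `W_f B_g V_{f′}`), the DIAGONAL RECIPE
  `tTab f f′ g := aTab f g f′ + apTab f g f′ − aTab f′ g f` (so that `M₂(h, h; B) = Σ_g Σ_{(f,f′)} t(f,f′;g)
  [h_{f′}, [B_g, h_f]]` over ORDERED pairs — engine check (M5)), and `vh2Tab f g h` = the coefficient of
  `[B_g, [B′_h, W_f]]` in `T2At` (Hall basis `{[b,[b′,w]], [b′,[b,w]]}`; the other coefficient is the `g ↔ h` mirror).
* §6 SUPPORT (root offset in the box: every table entry vanishes unless all its bonds are based in node 7a's support box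
  `Near L y`) and BLOCK COVARIANCE of the tables; UNIFORM BOUNDS by the finite absolute sums over the reference block.
* §7 THE PACKED KERNELS for an2: `mixFFAt ρ L κ u μ y : MKer (d+1) (Fib d)` (the `(inl, inl)` packing of `tTab`, exactly
  like node 7a's `hessFF`, with the extra background bond `(κ, u)`) and `vh₂SAt ρ L κ u κ′ u′` (node 7a's packer
  `packVH` applied to `vh2Tab` with the background bond `(κ, u)` closed over — the TYPE of `vhSAt … κ′ u′`), with
  their bi-localisation in the byte shapes of an2's `LocStencilFM` / `LocStencil₂` bodies (every rate `δ ≥ 0`, honest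
  constants = finite absolute sums × `e^{6(d+1)Lδ}`) and their block-translation covariance (`u ↦ u + L·t` jointly
  with `y ↦ y + t`, resp. `(u, u′) ↦ (u + L·t, u′ + L·t)`).
* §8 the `ρ = 0` BRIDGES BY NAME: `mixFF d L := mixFFAt 0 L`, `vh₂S d L := vh₂SAt 0 L` with `biLoc_mixFF`,
  `mixFF_translate`, `biLoc_vh₂S`, `vh₂S_translate` (an2-g10's requested names).

## What is NOT here

Not the analytic identification of these formal jets with the derivatives of B7 (42) (owed, as for node 12); not a
closed form of any table (none is claimed: the entries are DEFINED by extraction and only their support, covariance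
and finiteness are proved); not a reflection law (β-lead (R33)); not (D-i)(c). Nothing printed is asserted.
-/

namespace Literature.MathematicalPhysics.QuantumFieldTheory.Balaban1983to89.Beta.AveragingMixedJetTables

open Finset
open Literature.MathematicalPhysics.QuantumFieldTheory.Balaban1983to89.Beta.AffineAveraging
open Literature.MathematicalPhysics.QuantumFieldTheory.Balaban1983to89.Beta.AveragingContours
open Literature.MathematicalPhysics.QuantumFieldTheory.Balaban1983to89.Beta.AveragingContoursRooted
open Literature.MathematicalPhysics.QuantumFieldTheory.Balaban1983to89.Beta.TransportedContourVariables
open Literature.MathematicalPhysics.QuantumFieldTheory.Balaban1983to89.Beta.AveragingHessianKernels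
open Literature.MathematicalPhysics.QuantumFieldTheory.Balaban1983to89.Beta.AveragingHessianKernelsRooted
open Literature.MathematicalPhysics.QuantumFieldTheory.Balaban1983to89.Beta.AveragingThirdJet
open Literature.MathematicalPhysics.QuantumFieldTheory.Balaban1983to89.Beta.AveragingThirdJet.Tau

noncomputable section

/-! ## §1 Letters: oriented bonds, the letter shift, congruence of holonomies -/

section Letters

variable {𝕜 : Type*} [Field 𝕜] {d : ℕ} {R : Type*} [Ring R] [Algebra 𝕜 R]

/-- [folklore] Every letter of a signed straight segment is a (forward) bond letter. -/
theorem lettersIn_segUp_top {S : Type*} [AddCommGroup S] (A : Form1 d S) (z : Fin d → ℤ) (κ : Fin d) (n : ℕ) :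
    LettersIn A (fun _ => True) (segUp A z κ n) := fun a ha => by
  obtain ⟨s, -, rfl⟩ := mem_segUp ha
  exact ⟨κ, _, trivial, Or.inl rfl⟩

/-- [folklore] Every letter of the rooted contour `Γ^ρ_{c,x}` is an oriented bond letter (ANY root `ρ`). -/
theorem lettersIn_gammaCAt_top {S : Type*} [AddCommGroup S] (ρ : Fin d → ℤ) (A : Form1 d S) (L : ℕ) (μ : Fin d)
    (y : Fin d → ℤ) (b : Fin d → ℕ) : LettersIn A (fun _ => True) (gammaCAt ρ A L μ y b) :=
  (((lettersIn_axial A _ _).mono fun _ _ => trivial).append (lettersIn_segUp_top A _ _ _)).append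
    ((lettersIn_axial A _ _).mono fun _ _ => trivial).rev

/-- [folklore] Every letter of the rooted closed loop is an oriented bond letter (ANY root `ρ`). -/
theorem lettersIn_loopCAt_top {S : Type*} [AddCommGroup S] (ρ : Fin d → ℤ) (A : Form1 d S) (L : ℕ) (μ : Fin d)
    (y : Fin d → ℤ) (b : Fin d → ℕ) : LettersIn A (fun _ => True) (loopCAt ρ A L μ y b) :=
  (lettersIn_gammaCAt_top ρ A L μ y b).append (lettersIn_segUp_top A _ μ L).rev

/-- [folklore] THE LETTER SHIFT by `w`: the additive endomorphism `δ_{(κ,x)} ↦ δ_{(κ, x + w)}` of the free letter group. -/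
def shiftL (w : Fin d → ℤ) : LetterGrp d →+ LetterGrp d :=
  Finsupp.mapDomain.addMonoidHom fun p : Fin d × (Fin d → ℤ) => (p.1, p.2 + w)

/-- [folklore] The letter shift on a generator. -/
@[simp] theorem shiftL_δ (w : Fin d → ℤ) (κ : Fin d) (x : Fin d → ℤ) :
    shiftL w (δ κ x : LetterGrp d) = δ κ (x + w) := by
  simp [shiftL, δ, Finsupp.mapDomain_single]

/-- [folklore] Pushing the universal one-form along the letter shift is node 5's `shift` of it. -/
theorem mapForm_shiftL_δ (w : Fin d → ℤ) : mapForm (shiftL w) (δ : Form1 d (LetterGrp d)) = shift w δ := by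
  funext κ x; simp [shift]

omit [Algebra 𝕜 R] in
/-- [folklore] TRANSPORT UNDER THE LETTER SHIFT: the holonomy of a shifted letter list is the holonomy of the shifted
transporters along the original list. -/
theorem holG_map_shiftL (G Gb : Form1 d R) (w : Fin d → ℤ) {P : (Fin d → ℤ) → Prop} {l : List (LetterGrp d)}
    (hl : LettersIn δ P l) : holG G Gb (l.map (shiftL w)) = holG (shift w G) (shift w Gb) l := by
  induction l with
  | nil => simp
  | cons a l ih =>
    have hl' : LettersIn δ P l := fun b hb => hl b (by simp [hb])
    obtain ⟨κ, x, -, rfl | rfl⟩ := hl a (by simp)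
    · rw [List.map_cons, holG_cons, holG_cons, ih hl', shiftL_δ, realize_delta, realize_delta]; rfl
    · rw [List.map_cons, holG_cons, holG_cons, ih hl', map_neg, shiftL_δ, realize_neg_delta, realize_neg_delta]
      rfl

omit [Algebra 𝕜 R] in
/-- [folklore] CONGRUENCE: transporter pairs that agree on every bond based in the region `P` have the same holonomy
along any list of oriented bond letters based in `P`. -/
theorem holG_congr {G Gb G' Gb' : Form1 d R} {P : (Fin d → ℤ) → Prop} {l : List (LetterGrp d)}
    (hl : LettersIn δ P l) (hG : ∀ κ x, P x → G κ x = G' κ x) (hGb : ∀ κ x, P x → Gb κ x = Gb' κ x) :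
    holG G Gb l = holG G' Gb' l := by
  induction l with
  | nil => simp
  | cons a l ih =>
    have hl' : LettersIn δ P l := fun b hb => hl b (by simp [hb])
    obtain ⟨κ, x, hx, rfl | rfl⟩ := hl a (by simp)
    · rw [holG_cons, holG_cons, ih hl', realize_delta, realize_delta, hG κ x hx]
    · rw [holG_cons, holG_cons, ih hl', realize_neg_delta, realize_neg_delta, hGb κ x hx]

end Letters

/-! ## §2 The rooted one-step averaging `PhiGAt ρ` on group-valued transporters -/

section Averaging

variable (𝕜 : Type*) [Field 𝕜] {d : ℕ} {R R' : Type*} [Ring R] [Algebra 𝕜 R] [Ring R'] [Algebra 𝕜 R']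

/-- [folklore] THE ROOTED ONE-STEP COVARIANT AVERAGING (15)/(42) in node 12's truncated calculus, for a pair of
transporter assignments `(G, Ḡ)`: `Φ^ρ_b = expT( L^{−d} Σ_{x ∈ B(y)} logT hol(Γ^ρ_{c,x} ∪ (−c)) ) · hol(c)`,
`c = [L·y + ρ, L·y + ρ + L·e_μ]` — node 12's `PhiG` with node 5ρ's rooted lists. -/
def PhiGAt (ρ : Fin d → ℤ) (G Gb : Form1 d R) (L : ℕ) (μ : Fin d) (y : Fin d → ℤ) : R :=
  expT 𝕜 (((L : 𝕜) ^ d)⁻¹ • ∑ b ∈ box d L, logT 𝕜 (holG G Gb (loopCAt ρ δ L μ y b)))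
    * holG G Gb (segUp δ ((L : ℤ) • y + ρ) μ L)

variable {𝕜}

/-- [folklore] BRIDGE: at `ρ = 0` the rooted averaging IS node 12's `PhiG` (by name). -/
@[simp] theorem PhiGAt_zero (G Gb : Form1 d R) (L : ℕ) (μ : Fin d) (y : Fin d → ℤ) :
    PhiGAt 𝕜 0 G Gb L μ y = PhiG 𝕜 G Gb L μ y := by
  rw [PhiGAt, PhiG]; simp only [loopCAt_zero, add_zero]

/-- [folklore] NATURALITY of the rooted averaging under `𝕜`-algebra maps. -/
theorem map_PhiGAt (φ : R →ₐ[𝕜] R') (ρ : Fin d → ℤ) (G Gb : Form1 d R) (L : ℕ) (μ : Fin d) (y : Fin d → ℤ) :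
    φ (PhiGAt 𝕜 ρ G Gb L μ y) = PhiGAt 𝕜 ρ (fun κ x => φ (G κ x)) (fun κ x => φ (Gb κ x)) L μ y := by
  simp only [PhiGAt, map_mul, map_expT, map_smul, map_sum, map_logT, map_holG]

/-- [folklore] The rooted averaging of the trivial configuration is trivial. -/
theorem PhiGAt_one (ρ : Fin d → ℤ) (L : ℕ) (μ : Fin d) (y : Fin d → ℤ) :
    PhiGAt 𝕜 ρ (fun _ _ => (1 : R)) (fun _ _ => 1) L μ y = 1 := by
  have h1 : ∀ b ∈ box d L, logT 𝕜 (holG (fun _ _ => (1 : R)) (fun _ _ => 1) (loopCAt ρ δ L μ y b)) = 0 := by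
    intro b _
    rw [holG_one (lettersIn_loopCAt_top ρ δ L μ y b), logT_one]
  rw [PhiGAt, Finset.sum_congr rfl h1, Finset.sum_const_zero, smul_zero, expT_zero, one_mul,
    holG_one (lettersIn_segUp_top δ _ μ L)]

/-- [folklore] CONGRUENCE of the rooted averaging: transporter pairs agreeing on every bond based in a region that
contains the letters of all the lists give the same `Φ^ρ_b`. -/
theorem PhiGAt_congr {P : (Fin d → ℤ) → Prop} (ρ : Fin d → ℤ) {G Gb G' Gb' : Form1 d R} (L : ℕ) (μ : Fin d)
    (y : Fin d → ℤ) (hloop : ∀ b ∈ box d L, LettersIn δ P (loopCAt ρ δ L μ y b))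
    (hc : LettersIn δ P (segUp δ ((L : ℤ) • y + ρ) μ L)) (hG : ∀ κ x, P x → G κ x = G' κ x)
    (hGb : ∀ κ x, P x → Gb κ x = Gb' κ x) : PhiGAt 𝕜 ρ G Gb L μ y = PhiGAt 𝕜 ρ G' Gb' L μ y := by
  rw [PhiGAt, PhiGAt, holG_congr hc hG hGb,
    Finset.sum_congr rfl fun b hb => by rw [holG_congr (hloop b hb) hG hGb]]

/-- [folklore] CONGRUENCE for a root offset in the box: agreement on the bonds based in node 7a's support box
`Near L y` suffices. -/
theorem PhiGAt_congr_near {r : Fin d → ℕ} {L : ℕ} (hr : r ∈ box d L) {G Gb G' Gb' : Form1 d R} (μ : Fin d)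
    (y : Fin d → ℤ) (hG : ∀ κ x, Near L y x → G κ x = G' κ x) (hGb : ∀ κ x, Near L y x → Gb κ x = Gb' κ x) :
    PhiGAt 𝕜 (toSite r) G Gb L μ y = PhiGAt 𝕜 (toSite r) G' Gb' L μ y :=
  PhiGAt_congr (toSite r) L μ y (fun _ hb => lettersIn_loopCAt δ L μ y hr hb) (lettersIn_cSegAt δ L μ y hr) hG hGb

/-- [folklore] BLOCK TRANSLATION of the rooted averaging (the root offset rides along):
`Φ^ρ_{(μ, y + v)}(G, Ḡ) = Φ^ρ_{(μ, y)}(G(· + L v), Ḡ(· + L v))`. -/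
theorem PhiGAt_add (ρ : Fin d → ℤ) (G Gb : Form1 d R) (L : ℕ) (μ : Fin d) (y v : Fin d → ℤ) :
    PhiGAt 𝕜 ρ G Gb L μ (y + v) = PhiGAt 𝕜 ρ (shift ((L : ℤ) • v) G) (shift ((L : ℤ) • v) Gb) L μ y := by
  have hl : ∀ b, loopCAt ρ δ L μ (y + v) b = (loopCAt ρ δ L μ y b).map (shiftL ((L : ℤ) • v)) := by
    intro b; rw [loopCAt_add, ← mapForm_shiftL_δ, loopCAt_map]
  have hc : segUp δ ((L : ℤ) • (y + v) + ρ) μ L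
      = (segUp (δ : Form1 d (LetterGrp d)) ((L : ℤ) • y + ρ) μ L).map (shiftL ((L : ℤ) • v)) := by
    rw [segUp_map, mapForm_shiftL_δ, ← segUp_add]
    congr 1; rw [smul_add]; abel
  rw [PhiGAt, PhiGAt, hc, holG_map_shiftL _ _ _ (lettersIn_segUp_top δ _ μ L),
    Finset.sum_congr rfl fun b _ => by rw [hl, holG_map_shiftL _ _ _ (lettersIn_loopCAt_top ρ δ L μ y b)]]

end Averaging

/-! ## §3 The rooted averaged jet `QjetAt ρ` (node 12's chart) and the symmetrised `T2At` -/

section Qjet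

variable (𝕜 : Type*) [Field 𝕜] {d : ℕ} {𝔸 : Type*} [Ring 𝔸] [Algebra 𝕜 𝔸]

/-- [folklore] The rooted averaging on node 12's product chart `U_f = X_f E_f`. -/
def PhiRAt (ρ : Fin d → ℤ) (ω : Form1 d (Tau 𝔸)) (B B' : Form1 d 𝔸) (L : ℕ) (μ : Fin d) (y : Fin d → ℤ) :
    Rho 𝔸 :=
  PhiGAt 𝕜 ρ (Gf ω B B') (Gb ω B B') L μ y

/-- [folklore] THE ROOTED AVERAGED JET: node 12's `Qjet` verbatim over `PhiGAt ρ` — the `ρ`-coefficient of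
`logT( Φ^ρ_b(U) · invT(Φ^ρ_b(E)) )`. -/
def QjetAt (ρ : Fin d → ℤ) (ω : Form1 d (Tau 𝔸)) (B B' : Form1 d 𝔸) (L : ℕ) (μ : Fin d) (y : Fin d → ℤ) :
    Tau 𝔸 :=
  (logT 𝕜 (PhiRAt 𝕜 ρ ω B B' L μ y * invT (PhiRAt 𝕜 ρ 0 B B' L μ y))).snd

/-- [folklore] BRIDGE: `PhiRAt 0 = PhiR` (node 12 by name). -/
@[simp] theorem PhiRAt_zero (ω : Form1 d (Tau 𝔸)) (B B' : Form1 d 𝔸) (L : ℕ) (μ : Fin d) (y : Fin d → ℤ) :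
    PhiRAt 𝕜 0 ω B B' L μ y = PhiR 𝕜 ω B B' L μ y := by
  rw [PhiRAt, PhiGAt_zero]; rfl

/-- [folklore] BRIDGE: `QjetAt 0 = Qjet` (node 12 by name). -/
@[simp] theorem QjetAt_zero (ω : Form1 d (Tau 𝔸)) (B B' : Form1 d 𝔸) (L : ℕ) (μ : Fin d) (y : Fin d → ℤ) :
    QjetAt 𝕜 0 ω B B' L μ y = Qjet 𝕜 ω B B' L μ y := by
  rw [QjetAt, PhiRAt_zero, PhiRAt_zero]; rfl

/-- [folklore] THE SYMMETRISED SECOND-ORDER BACKGROUND RESPONSE (lit3/an2's `T₂pol`): the sum of the two ordered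
`τ₁τ₂`-components, `T2At ρ ω B B′ = c11 (QjetAt ρ ω B B′) + c11 (QjetAt ρ ω B′ B)`. -/
def T2At (ρ : Fin d → ℤ) (ω : Form1 d (Tau 𝔸)) (B B' : Form1 d 𝔸) (L : ℕ) (μ : Fin d) (y : Fin d → ℤ) : 𝔸 :=
  c11 (QjetAt 𝕜 ρ ω B B' L μ y) + c11 (QjetAt 𝕜 ρ ω B' B L μ y)

/-- [folklore] `T2At` is symmetric in the two backgrounds (by construction). -/
theorem T2At_symm (ρ : Fin d → ℤ) (ω : Form1 d (Tau 𝔸)) (B B' : Form1 d 𝔸) (L : ℕ) (μ : Fin d)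
    (y : Fin d → ℤ) : T2At 𝕜 ρ ω B' B L μ y = T2At 𝕜 ρ ω B B' L μ y := add_comm _ _

/-- [folklore] BRIDGE: `T2At 0 ω B B′ = c11 (Qjet ω B B′) + c11 (Qjet ω B′ B)` (node 12 by name). -/
theorem T2At_zero (ω : Form1 d (Tau 𝔸)) (B B' : Form1 d 𝔸) (L : ℕ) (μ : Fin d) (y : Fin d → ℤ) :
    T2At 𝕜 0 ω B B' L μ y = c11 (Qjet 𝕜 ω B B' L μ y) + c11 (Qjet 𝕜 ω B' B L μ y) := by
  rw [T2At, QjetAt_zero, QjetAt_zero]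

/-- [folklore] BLOCK TRANSLATION of `PhiRAt`. -/
theorem PhiRAt_add (ρ : Fin d → ℤ) (ω : Form1 d (Tau 𝔸)) (B B' : Form1 d 𝔸) (L : ℕ) (μ : Fin d)
    (y v : Fin d → ℤ) :
    PhiRAt 𝕜 ρ ω B B' L μ (y + v)
      = PhiRAt 𝕜 ρ (shift ((L : ℤ) • v) ω) (shift ((L : ℤ) • v) B) (shift ((L : ℤ) • v) B') L μ y := by
  rw [PhiRAt, PhiGAt_add]; rfl

/-- [folklore] BLOCK TRANSLATION of the rooted jet. -/
theorem QjetAt_add (ρ : Fin d → ℤ) (ω : Form1 d (Tau 𝔸)) (B B' : Form1 d 𝔸) (L : ℕ) (μ : Fin d)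
    (y v : Fin d → ℤ) :
    QjetAt 𝕜 ρ ω B B' L μ (y + v)
      = QjetAt 𝕜 ρ (shift ((L : ℤ) • v) ω) (shift ((L : ℤ) • v) B) (shift ((L : ℤ) • v) B') L μ y := by
  rw [QjetAt, QjetAt, PhiRAt_add, PhiRAt_add]; rfl

/-- [folklore] BLOCK TRANSLATION of `T2At`. -/
theorem T2At_add (ρ : Fin d → ℤ) (ω : Form1 d (Tau 𝔸)) (B B' : Form1 d 𝔸) (L : ℕ) (μ : Fin d)
    (y v : Fin d → ℤ) :
    T2At 𝕜 ρ ω B B' L μ (y + v)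
      = T2At 𝕜 ρ (shift ((L : ℤ) • v) ω) (shift ((L : ℤ) • v) B) (shift ((L : ℤ) • v) B') L μ y := by
  rw [T2At, T2At, QjetAt_add, QjetAt_add]

/-- [folklore] CONGRUENCE of `PhiRAt` for a root offset in the box. -/
theorem PhiRAt_congr_near {r : Fin d → ℕ} {L : ℕ} (hr : r ∈ box d L) {ω ω' : Form1 d (Tau 𝔸)}
    {B B₁ B' B₁' : Form1 d 𝔸} (μ : Fin d) (y : Fin d → ℤ) (hω : ∀ κ x, Near L y x → ω κ x = ω' κ x)
    (hB : ∀ κ x, Near L y x → B κ x = B₁ κ x) (hB' : ∀ κ x, Near L y x → B' κ x = B₁' κ x) :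
    PhiRAt 𝕜 (toSite r) ω B B' L μ y = PhiRAt 𝕜 (toSite r) ω' B₁ B₁' L μ y :=
  PhiGAt_congr_near hr μ y (fun κ x hx => by simp only [Gf, Ebg, hω κ x hx, hB κ x hx, hB' κ x hx])
    (fun κ x hx => by simp only [Gb, Ebi, hω κ x hx, hB κ x hx, hB' κ x hx])

/-- [folklore] CONGRUENCE of the rooted jet for a root offset in the box. -/
theorem QjetAt_congr_near {r : Fin d → ℕ} {L : ℕ} (hr : r ∈ box d L) {ω ω' : Form1 d (Tau 𝔸)}
    {B B₁ B' B₁' : Form1 d 𝔸} (μ : Fin d) (y : Fin d → ℤ) (hω : ∀ κ x, Near L y x → ω κ x = ω' κ x)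
    (hB : ∀ κ x, Near L y x → B κ x = B₁ κ x) (hB' : ∀ κ x, Near L y x → B' κ x = B₁' κ x) :
    QjetAt 𝕜 (toSite r) ω B B' L μ y = QjetAt 𝕜 (toSite r) ω' B₁ B₁' L μ y := by
  rw [QjetAt, QjetAt, PhiRAt_congr_near 𝕜 hr μ y hω hB hB',
    PhiRAt_congr_near 𝕜 hr μ y (fun _ _ _ => rfl) hB hB']

/-! ### Vanishing of `T2At` when a slot vanishes -/

/-- [folklore] The `τ₁`-KILLING endomorphism of `Tau 𝔸` (`τ₁ ↦ 0`). -/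
def k1 : Tau 𝔸 →ₐ[𝕜] Tau 𝔸 := mapDual (scaleDual (0 : 𝔸) fun t => by rw [zero_mul, mul_zero])

/-- [folklore] The `τ₂`-KILLING endomorphism of `Tau 𝔸` (`τ₂ ↦ 0`). -/
def k2 : Tau 𝔸 →ₐ[𝕜] Tau 𝔸 := scaleDual (0 : DualNumber 𝔸) fun t => by rw [zero_mul, mul_zero]

/-- [folklore] `k1` keeps `c00`. -/
@[simp] theorem c00_k1 (q : Tau 𝔸) : c00 (k1 𝕜 q) = c00 q := rfl
/-- [folklore] `k1` kills `c10`. -/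
@[simp] theorem c10_k1 (q : Tau 𝔸) : c10 (k1 𝕜 q) = 0 := by simp [k1, c10]
/-- [folklore] `k1` keeps `c01`. -/
@[simp] theorem c01_k1 (q : Tau 𝔸) : c01 (k1 𝕜 q) = c01 q := rfl
/-- [folklore] `k1` kills `c11`. -/
@[simp] theorem c11_k1 (q : Tau 𝔸) : c11 (k1 𝕜 q) = 0 := by simp [k1, c11]
/-- [folklore] `k2` keeps `c00`. -/
@[simp] theorem c00_k2 (q : Tau 𝔸) : c00 (k2 𝕜 q) = c00 q := rfl
/-- [folklore] `k2` keeps `c10`. -/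
@[simp] theorem c10_k2 (q : Tau 𝔸) : c10 (k2 𝕜 q) = c10 q := rfl
/-- [folklore] `k2` kills `c01`. -/
@[simp] theorem c01_k2 (q : Tau 𝔸) : c01 (k2 𝕜 q) = 0 := by simp [k2, c01]
/-- [folklore] `k2` kills `c11`. -/
@[simp] theorem c11_k2 (q : Tau 𝔸) : c11 (k2 𝕜 q) = 0 := by simp [k2, c11]

/-- [folklore] The `σ`-KILLING endomorphism of `Rho 𝔸` (outer parameter `↦ 0`). -/
def kσ : Rho 𝔸 →ₐ[𝕜] Rho 𝔸 := scaleDual (0 : Tau 𝔸) fun t => by rw [zero_mul, mul_zero]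

/-- [folklore] Components of `kσ`. -/
theorem kσ_apply (p : Rho 𝔸) : kσ 𝕜 p = dmk p.fst 0 :=
  TrivSqZeroExt.ext (by simp [kσ]) (by simp [kσ])

omit [Algebra 𝕜 𝔸] in
/-- [folklore] `Tau.mk 0 0 0 0 = 0`. -/
@[simp] theorem mk_zero₄ : (Tau.mk 0 0 0 0 : Tau 𝔸) = 0 := rfl

end Qjet

/-! ## §4 The mixed chart `U_f = e^{τ₁W_f + τ₂V_f} · e^{σB_f}` and the mixed jet `MjetAt ρ` -/

section Mixed

variable (𝕜 : Type*) [Field 𝕜] {d : ℕ} {𝔸 : Type*} [Ring 𝔸] [Algebra 𝕜 𝔸]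

/-- [folklore] THE SYMMETRIC EXPONENTIAL FLUCTUATION LETTER `Z_f = expT(τ₁ W_f + τ₂ V_f)
= 1 + τ₁ W_f + τ₂ V_f + ½ τ₁τ₂ (W_f V_f + V_f W_f)` (exact: `τ₁² = τ₂² = 0`), symmetric in `W ↔ V`. -/
def Zf (W V : Form1 d 𝔸) : Form1 d (Tau 𝔸) := fun κ x =>
  Tau.mk 1 (W κ x) (V κ x) ((2 : 𝕜)⁻¹ • (W κ x * V κ x + V κ x * W κ x))

/-- [folklore] … and the backward letter `expT(−τ₁ W_f − τ₂ V_f)` (same symmetric `τ₁τ₂`-part). -/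
def Zb (W V : Form1 d 𝔸) : Form1 d (Tau 𝔸) := fun κ x =>
  Tau.mk 1 (-W κ x) (-V κ x) ((2 : 𝕜)⁻¹ • (W κ x * V κ x + V κ x * W κ x))

/-- [folklore] THE MIXED CHART, fluctuation pair LEFT: forward transporter `U_f = Z_f · (1 + σ B_f)`, as the element
`(Z_f, Z_f B_f)` of `Rho 𝔸 = (Tau 𝔸)[σ]`. -/
def Gm (W V B : Form1 d 𝔸) : Form1 d (Rho 𝔸) := fun κ x => dmk (Zf 𝕜 W V κ x) (Zf 𝕜 W V κ x * ι (B κ x))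

/-- [folklore] … backward transporter `U_f⁻¹ = (1 − σ B_f) · Z_f⁻¹ = (Z_f⁻¹, −B_f Z_f⁻¹)`. -/
def Gmb (W V B : Form1 d 𝔸) : Form1 d (Rho 𝔸) := fun κ x =>
  dmk (Zb 𝕜 W V κ x) (-(ι (B κ x) * Zb 𝕜 W V κ x))

/-- [folklore] The rooted averaging on the mixed chart. -/
def PhiMAt (ρ : Fin d → ℤ) (W V B : Form1 d 𝔸) (L : ℕ) (μ : Fin d) (y : Fin d → ℤ) : Rho 𝔸 :=
  PhiGAt 𝕜 ρ (Gm 𝕜 W V B) (Gmb 𝕜 W V B) L μ y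

/-- [folklore] THE RIGHT-TRIVIALISED MIXED JET `M^ρ_b(W, V; B)`: the `τ₁τ₂σ`-coefficient of
`logT( Φ^ρ_b(U) · invT Φ^ρ_b(E) )`, `U = e^{τ₁W+τ₂V} e^{σB}`, `E = e^{σB}` — by construction bilinear-symmetric in
the fluctuation pair `(W, V)` at the level of the chart and linear in the background `B`; the letter-level second
W-derivative of the averaged first-order background response (VALUES: an1 `engine_m2.py` (s s′ t)-coefficient `M2`,
two-engine diff 28/28 PASS with lit3; provenance only). -/
def MjetAt (ρ : Fin d → ℤ) (W V B : Form1 d 𝔸) (L : ℕ) (μ : Fin d) (y : Fin d → ℤ) : 𝔸 :=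
  c11 ((logT 𝕜 (PhiMAt 𝕜 ρ W V B L μ y * invT (PhiMAt 𝕜 ρ 0 0 B L μ y))).snd)

/-! ### The three killing homomorphisms on the letters of the mixed chart -/

/-- [folklore] `k1 Z_f(W,V) = Z_f(0,V)`. -/
theorem k1_Zf (W V : Form1 d 𝔸) (κ : Fin d) (x : Fin d → ℤ) : k1 𝕜 (Zf 𝕜 W V κ x) = Zf 𝕜 0 V κ x :=
  ext4 (by simp [Zf]) (by simp [Zf]) (by simp [Zf]) (by simp [Zf])

/-- [folklore] `k1 Z_f⁻¹(W,V) = Z_f⁻¹(0,V)`. -/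
theorem k1_Zb (W V : Form1 d 𝔸) (κ : Fin d) (x : Fin d → ℤ) : k1 𝕜 (Zb 𝕜 W V κ x) = Zb 𝕜 0 V κ x :=
  ext4 (by simp [Zb]) (by simp [Zb]) (by simp [Zb]) (by simp [Zb])

/-- [folklore] `k2 Z_f(W,V) = Z_f(W,0)`. -/
theorem k2_Zf (W V : Form1 d 𝔸) (κ : Fin d) (x : Fin d → ℤ) : k2 𝕜 (Zf 𝕜 W V κ x) = Zf 𝕜 W 0 κ x :=
  ext4 (by simp [Zf]) (by simp [Zf]) (by simp [Zf]) (by simp [Zf])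

/-- [folklore] `k2 Z_f⁻¹(W,V) = Z_f⁻¹(W,0)`. -/
theorem k2_Zb (W V : Form1 d 𝔸) (κ : Fin d) (x : Fin d → ℤ) : k2 𝕜 (Zb 𝕜 W V κ x) = Zb 𝕜 W 0 κ x :=
  ext4 (by simp [Zb]) (by simp [Zb]) (by simp [Zb]) (by simp [Zb])

/-- [folklore] `k1` fixes the scalars. -/
@[simp] theorem k1_ι (a : 𝔸) : k1 𝕜 (ι a) = ι a := ext4 (by simp) (by simp) (by simp) (by simp)

/-- [folklore] `k2` fixes the scalars. -/
@[simp] theorem k2_ι (a : 𝔸) : k2 𝕜 (ι a) = ι a := ext4 (by simp) (by simp) (by simp) (by simp)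

/-- [folklore] Killing `τ₁` on the forward letter kills `W`. -/
theorem k1_Gm (W V B : Form1 d 𝔸) (κ : Fin d) (x : Fin d → ℤ) :
    mapDual (k1 𝕜) (Gm 𝕜 W V B κ x) = Gm 𝕜 0 V B κ x :=
  TrivSqZeroExt.ext (by simp [Gm, k1_Zf]) (by simp [Gm, map_mul, k1_Zf])

/-- [folklore] Killing `τ₁` on the backward letter kills `W`. -/
theorem k1_Gmb (W V B : Form1 d 𝔸) (κ : Fin d) (x : Fin d → ℤ) :
    mapDual (k1 𝕜) (Gmb 𝕜 W V B κ x) = Gmb 𝕜 0 V B κ x :=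
  TrivSqZeroExt.ext (by simp [Gmb, k1_Zb]) (by simp [Gmb, map_mul, map_neg, k1_Zb])

/-- [folklore] Killing `τ₂` on the forward letter kills `V`. -/
theorem k2_Gm (W V B : Form1 d 𝔸) (κ : Fin d) (x : Fin d → ℤ) :
    mapDual (k2 𝕜) (Gm 𝕜 W V B κ x) = Gm 𝕜 W 0 B κ x :=
  TrivSqZeroExt.ext (by simp [Gm, k2_Zf]) (by simp [Gm, map_mul, k2_Zf])

/-- [folklore] Killing `τ₂` on the backward letter kills `V`. -/
theorem k2_Gmb (W V B : Form1 d 𝔸) (κ : Fin d) (x : Fin d → ℤ) :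
    mapDual (k2 𝕜) (Gmb 𝕜 W V B κ x) = Gmb 𝕜 W 0 B κ x :=
  TrivSqZeroExt.ext (by simp [Gmb, k2_Zb]) (by simp [Gmb, map_mul, map_neg, k2_Zb])

/-- [folklore] Killing `σ` on the forward letter kills `B`. -/
theorem kσ_Gm (W V B : Form1 d 𝔸) (κ : Fin d) (x : Fin d → ℤ) :
    kσ 𝕜 (Gm 𝕜 W V B κ x) = Gm 𝕜 W V 0 κ x :=
  TrivSqZeroExt.ext (by simp [Gm, kσ_apply]) (by simp [Gm, ι, kσ_apply])

/-- [folklore] Killing `σ` on the backward letter kills `B`. -/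
theorem kσ_Gmb (W V B : Form1 d 𝔸) (κ : Fin d) (x : Fin d → ℤ) :
    kσ 𝕜 (Gmb 𝕜 W V B κ x) = Gmb 𝕜 W V 0 κ x :=
  TrivSqZeroExt.ext (by simp [Gmb, kσ_apply]) (by simp [Gmb, ι, kσ_apply])

/-- [folklore] Killing `τ₁` on the averaging kills `W`. -/
theorem k1_PhiMAt (ρ : Fin d → ℤ) (W V B : Form1 d 𝔸) (L : ℕ) (μ : Fin d) (y : Fin d → ℤ) :
    mapDual (k1 𝕜) (PhiMAt 𝕜 ρ W V B L μ y) = PhiMAt 𝕜 ρ 0 V B L μ y := by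
  rw [PhiMAt, PhiMAt, map_PhiGAt]; simp only [k1_Gm, k1_Gmb]; try rfl

/-- [folklore] Killing `τ₂` on the averaging kills `V`. -/
theorem k2_PhiMAt (ρ : Fin d → ℤ) (W V B : Form1 d 𝔸) (L : ℕ) (μ : Fin d) (y : Fin d → ℤ) :
    mapDual (k2 𝕜) (PhiMAt 𝕜 ρ W V B L μ y) = PhiMAt 𝕜 ρ W 0 B L μ y := by
  rw [PhiMAt, PhiMAt, map_PhiGAt]; simp only [k2_Gm, k2_Gmb]; try rfl

/-- [folklore] Killing `σ` on the averaging kills `B`. -/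
theorem kσ_PhiMAt (ρ : Fin d → ℤ) (W V B : Form1 d 𝔸) (L : ℕ) (μ : Fin d) (y : Fin d → ℤ) :
    kσ 𝕜 (PhiMAt 𝕜 ρ W V B L μ y) = PhiMAt 𝕜 ρ W V 0 L μ y := by
  rw [PhiMAt, PhiMAt, map_PhiGAt]; simp only [kσ_Gm, kσ_Gmb]; try rfl

/-- [folklore] **The mixed jet VANISHES without the first fluctuation.** -/
theorem MjetAt_W_zero (ρ : Fin d → ℤ) (V B : Form1 d 𝔸) (L : ℕ) (μ : Fin d) (y : Fin d → ℤ) :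
    MjetAt 𝕜 ρ 0 V B L μ y = 0 := by
  have e := congrArg (fun Z : Rho 𝔸 => c11 Z.snd)
    (map_logT (mapDual (k1 𝕜)) (PhiMAt 𝕜 ρ 0 V B L μ y * invT (PhiMAt 𝕜 ρ 0 0 B L μ y)))
  simp only [map_mul, map_invT, k1_PhiMAt, snd_mapDual, c11_k1] at e
  rw [MjetAt]; exact e.symm

/-- [folklore] **The mixed jet VANISHES without the second fluctuation.** -/
theorem MjetAt_V_zero (ρ : Fin d → ℤ) (W B : Form1 d 𝔸) (L : ℕ) (μ : Fin d) (y : Fin d → ℤ) :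
    MjetAt 𝕜 ρ W 0 B L μ y = 0 := by
  have e := congrArg (fun Z : Rho 𝔸 => c11 Z.snd)
    (map_logT (mapDual (k2 𝕜)) (PhiMAt 𝕜 ρ W 0 B L μ y * invT (PhiMAt 𝕜 ρ 0 0 B L μ y)))
  simp only [map_mul, map_invT, k2_PhiMAt, snd_mapDual, c11_k2] at e
  rw [MjetAt]; exact e.symm

/-- [folklore] **The mixed jet VANISHES without the background** (`Φ(U)Φ(U)⁻¹`-trivial `σ`-slot). -/
theorem MjetAt_B_zero (ρ : Fin d → ℤ) (W V : Form1 d 𝔸) (L : ℕ) (μ : Fin d) (y : Fin d → ℤ) :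
    MjetAt 𝕜 ρ W V 0 L μ y = 0 := by
  have e := congrArg (fun Z : Rho 𝔸 => c11 Z.snd)
    (map_logT (kσ 𝕜) (PhiMAt 𝕜 ρ W V 0 L μ y * invT (PhiMAt 𝕜 ρ 0 0 0 L μ y)))
  simp only [map_mul, map_invT, kσ_PhiMAt] at e
  simp only [kσ_apply, snd_dmk, c11_zero] at e
  rw [MjetAt]; exact e.symm

/-- [folklore] BLOCK TRANSLATION of the mixed averaging. -/
theorem PhiMAt_add (ρ : Fin d → ℤ) (W V B : Form1 d 𝔸) (L : ℕ) (μ : Fin d) (y v : Fin d → ℤ) :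
    PhiMAt 𝕜 ρ W V B L μ (y + v)
      = PhiMAt 𝕜 ρ (shift ((L : ℤ) • v) W) (shift ((L : ℤ) • v) V) (shift ((L : ℤ) • v) B) L μ y := by
  rw [PhiMAt, PhiGAt_add]; rfl

/-- [folklore] BLOCK TRANSLATION of the mixed jet. -/
theorem MjetAt_add (ρ : Fin d → ℤ) (W V B : Form1 d 𝔸) (L : ℕ) (μ : Fin d) (y v : Fin d → ℤ) :
    MjetAt 𝕜 ρ W V B L μ (y + v)
      = MjetAt 𝕜 ρ (shift ((L : ℤ) • v) W) (shift ((L : ℤ) • v) V) (shift ((L : ℤ) • v) B) L μ y := by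
  rw [MjetAt, MjetAt, PhiMAt_add, PhiMAt_add]; rfl

/-- [folklore] CONGRUENCE of the mixed averaging for a root offset in the box. -/
theorem PhiMAt_congr_near {r : Fin d → ℕ} {L : ℕ} (hr : r ∈ box d L) {W W' V V' B B' : Form1 d 𝔸}
    (μ : Fin d) (y : Fin d → ℤ) (hW : ∀ κ x, Near L y x → W κ x = W' κ x)
    (hV : ∀ κ x, Near L y x → V κ x = V' κ x) (hB : ∀ κ x, Near L y x → B κ x = B' κ x) :
    PhiMAt 𝕜 (toSite r) W V B L μ y = PhiMAt 𝕜 (toSite r) W' V' B' L μ y :=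
  PhiGAt_congr_near hr μ y (fun κ x hx => by simp only [Gm, Zf, hW κ x hx, hV κ x hx, hB κ x hx])
    (fun κ x hx => by simp only [Gmb, Zb, hW κ x hx, hV κ x hx, hB κ x hx])

/-- [folklore] CONGRUENCE of the mixed jet for a root offset in the box: fluctuations and background may be changed
off node 7a's support box `Near L y` without changing `M^ρ_b`. -/
theorem MjetAt_congr_near {r : Fin d → ℕ} {L : ℕ} (hr : r ∈ box d L) {W W' V V' B B' : Form1 d 𝔸}
    (μ : Fin d) (y : Fin d → ℤ) (hW : ∀ κ x, Near L y x → W κ x = W' κ x)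
    (hV : ∀ κ x, Near L y x → V κ x = V' κ x) (hB : ∀ κ x, Near L y x → B κ x = B' κ x) :
    MjetAt 𝕜 (toSite r) W V B L μ y = MjetAt 𝕜 (toSite r) W' V' B' L μ y := by
  rw [MjetAt, MjetAt, PhiMAt_congr_near 𝕜 hr μ y hW hV hB,
    PhiMAt_congr_near 𝕜 hr μ y (fun _ _ _ => rfl) (fun _ _ _ => rfl) hB]

/-! ### Vanishing, translation and congruence of `T2At` -/

/-- [folklore] Killing `σ`… on node 12's chart: the fluctuation letter sits in the outer slot, so `kσ` kills `ω`. -/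
theorem kσ_Gf (ω : Form1 d (Tau 𝔸)) (B B' : Form1 d 𝔸) (κ : Fin d) (x : Fin d → ℤ) :
    kσ 𝕜 (Gf ω B B' κ x) = Gf 0 B B' κ x :=
  TrivSqZeroExt.ext (by simp [Gf, kσ_apply]) (by simp [Gf, kσ_apply])

/-- [folklore] … and on the backward letter. -/
theorem kσ_Gb (ω : Form1 d (Tau 𝔸)) (B B' : Form1 d 𝔸) (κ : Fin d) (x : Fin d → ℤ) :
    kσ 𝕜 (Gb ω B B' κ x) = Gb 0 B B' κ x :=
  TrivSqZeroExt.ext (by simp [Gb, kσ_apply]) (by simp [Gb, kσ_apply])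

/-- [folklore] `k1` kills `B` on node 12's background letter `E_f = (1 + τ₁B)(1 + τ₂B′)`. -/
theorem k1_Ebg (B B' : Form1 d 𝔸) (κ : Fin d) (x : Fin d → ℤ) : k1 𝕜 (Ebg B B' κ x) = Ebg 0 B' κ x :=
  ext4 (by simp [Ebg]) (by simp [Ebg]) (by simp [Ebg]) (by simp [Ebg])

/-- [folklore] `k1` kills `B` on `E_f⁻¹`. -/
theorem k1_Ebi (B B' : Form1 d 𝔸) (κ : Fin d) (x : Fin d → ℤ) : k1 𝕜 (Ebi B B' κ x) = Ebi 0 B' κ x :=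
  ext4 (by simp [Ebi]) (by simp [Ebi]) (by simp [Ebi]) (by simp [Ebi])

/-- [folklore] `k2` kills `B′` on `E_f`. -/
theorem k2_Ebg (B B' : Form1 d 𝔸) (κ : Fin d) (x : Fin d → ℤ) : k2 𝕜 (Ebg B B' κ x) = Ebg B 0 κ x :=
  ext4 (by simp [Ebg]) (by simp [Ebg]) (by simp [Ebg]) (by simp [Ebg])

/-- [folklore] `k2` kills `B′` on `E_f⁻¹`. -/
theorem k2_Ebi (B B' : Form1 d 𝔸) (κ : Fin d) (x : Fin d → ℤ) : k2 𝕜 (Ebi B B' κ x) = Ebi B 0 κ x :=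
  ext4 (by simp [Ebi]) (by simp [Ebi]) (by simp [Ebi]) (by simp [Ebi])

end Mixed

/-! ## §5 Scalar tables by word-coefficient extraction in the path algebra `Matrix (Fin 4) (Fin 4) ℚ` -/

section Tables

/-- [folklore] THE PATH ALGEBRA of the quiver `0 → 1 → 2 → 3`'s ambient matrix ring: `4 × 4` rational matrices. A
letter placed on the matrix unit `E_{i,i+1}` at ONE bond (and `0` at every other bond) turns the `(0,3)` entry of a
trilinear expression into the coefficient of the single word whose letters appear in the order `E₀₁ E₁₂ E₂₃`. -/
abbrev UT : Type := Matrix (Fin 4) (Fin 4) ℚ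

/-- [folklore] The matrix unit `E_{ij}`. -/
def E (i j : Fin 4) : UT := Matrix.single i j 1

variable {d : ℕ}

/-- [folklore] TABLE `a(f, g, f′)`: the coefficient of the word `W_f V_{f′} B_g` in `M^ρ_b(W, V; B)` (= the coefficient
of `[B_g, [V_{f′}, W_f]]` in the Hall basis `{[b,[v,w]], [v,[b,w]]}`; engine key `(fW, fB, fP) ↦ a`). -/
def aTab (ρ : Fin d → ℤ) (L : ℕ) (μ : Fin d) (y : Fin d → ℤ) (f g f' : Bond d) : ℚ :=
  MjetAt ℚ ρ (single f (E 0 1)) (single f' (E 1 2)) (single g (E 2 3)) L μ y 0 3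

/-- [folklore] TABLE `a′(f, g, f′)`: the coefficient of the word `W_f B_g V_{f′}` in `M^ρ_b(W, V; B)` (= the
coefficient of `[V_{f′}, [B_g, W_f]]`; engine key `(fW, fB, fP) ↦ a′`). -/
def apTab (ρ : Fin d → ℤ) (L : ℕ) (μ : Fin d) (y : Fin d → ℤ) (f g f' : Bond d) : ℚ :=
  MjetAt ℚ ρ (single f (E 0 1)) (single f' (E 2 3)) (single g (E 1 2)) L μ y 0 3

/-- [folklore] THE DIAGONAL RECIPE `t(f, f′; g) := a(f,g,f′) + a′(f,g,f′) − a(f′,g,f)`: the table over ORDERED pairs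
of fluctuation bonds such that `M^ρ_b(h, h; B) = Σ_g Σ_{(f,f′)} t(f,f′;g) [h_{f′}, [B_g, h_f]]` (engine check (M5),
two-engine (D5); provenance only — nothing about the values is asserted here). -/
def tTab (ρ : Fin d → ℤ) (L : ℕ) (μ : Fin d) (y : Fin d → ℤ) (f f' g : Bond d) : ℚ :=
  aTab ρ L μ y f g f' + apTab ρ L μ y f g f' - aTab ρ L μ y f' g f

/-- [folklore] TABLE `s(f; g, h)`: the coefficient of the word `B_g B′_h W_f` in `T2At` (= the coefficient of
`[B_g, [B′_h, W_f]]` in the Hall basis `{[b,[b′,w]], [b′,[b,w]]}`; the other coefficient is `s(f; h, g)` by the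
symmetry of `T2At`). -/
def vh2Tab (ρ : Fin d → ℤ) (L : ℕ) (μ : Fin d) (y : Fin d → ℤ) (f g h : Bond d) : ℚ :=
  T2At ℚ ρ (upF (single f (E 2 3))) (single g (E 0 1)) (single h (E 1 2)) L μ y 0 3

end Tables

/-! ## §6 Support, block covariance and finiteness of the tables -/

section Structure

variable {d : ℕ}

/-! ### Vanishing of the jets slot by slot (node 12's chart) -/

section QjetVanishing

variable (𝕜 : Type*) [Field 𝕜] {𝔸 : Type*} [Ring 𝔸] [Algebra 𝕜 𝔸]

/-- [folklore] Killing `σ` on node 12's rooted averaging kills the fluctuation letter. -/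
theorem kσ_PhiRAt (ρ : Fin d → ℤ) (ω : Form1 d (Tau 𝔸)) (B B' : Form1 d 𝔸) (L : ℕ) (μ : Fin d)
    (y : Fin d → ℤ) : kσ 𝕜 (PhiRAt 𝕜 ρ ω B B' L μ y) = PhiRAt 𝕜 ρ 0 B B' L μ y := by
  rw [PhiRAt, PhiRAt, map_PhiGAt]; simp only [kσ_Gf, kσ_Gb]; try rfl

/-- [folklore] **The rooted jet VANISHES without fluctuation**: `QjetAt ρ 0 B B′ = 0`. -/
theorem QjetAt_ω_zero (ρ : Fin d → ℤ) (B B' : Form1 d 𝔸) (L : ℕ) (μ : Fin d) (y : Fin d → ℤ) :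
    QjetAt 𝕜 ρ 0 B B' L μ y = 0 := by
  have e := congrArg TrivSqZeroExt.snd
    (map_logT (kσ 𝕜) (PhiRAt 𝕜 ρ 0 B B' L μ y * invT (PhiRAt 𝕜 ρ 0 B B' L μ y)))
  simp only [map_mul, map_invT, kσ_PhiRAt] at e
  rw [kσ_apply, snd_dmk] at e
  rw [QjetAt]; exact e.symm

/-- [folklore] `k1` on the forward letter of node 12's chart with a scalar fluctuation kills `B`. -/
theorem k1_Gf_upF (W B B' : Form1 d 𝔸) (κ : Fin d) (x : Fin d → ℤ) :
    mapDual (k1 𝕜) (Gf (upF W) B B' κ x) = Gf (upF W) 0 B' κ x :=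
  TrivSqZeroExt.ext (by simp [Gf, k1_Ebg]) (by simp [Gf, k1_Ebg])

/-- [folklore] … backward letter. -/
theorem k1_Gb_upF (W B B' : Form1 d 𝔸) (κ : Fin d) (x : Fin d → ℤ) :
    mapDual (k1 𝕜) (Gb (upF W) B B' κ x) = Gb (upF W) 0 B' κ x :=
  TrivSqZeroExt.ext (by simp [Gb, k1_Ebi]) (by simp [Gb, k1_Ebi])

/-- [folklore] `k1` on the pure-background forward letter kills `B`. -/
theorem k1_Gf_zero (B B' : Form1 d 𝔸) (κ : Fin d) (x : Fin d → ℤ) :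
    mapDual (k1 𝕜) (Gf 0 B B' κ x) = Gf 0 0 B' κ x :=
  TrivSqZeroExt.ext (by simp [Gf, k1_Ebg]) (by simp [Gf, k1_Ebg])

/-- [folklore] … backward letter. -/
theorem k1_Gb_zero (B B' : Form1 d 𝔸) (κ : Fin d) (x : Fin d → ℤ) :
    mapDual (k1 𝕜) (Gb 0 B B' κ x) = Gb 0 0 B' κ x :=
  TrivSqZeroExt.ext (by simp [Gb, k1_Ebi]) (by simp [Gb, k1_Ebi])

/-- [folklore] `k2` on the forward letter with a scalar fluctuation kills `B′`. -/
theorem k2_Gf_upF (W B B' : Form1 d 𝔸) (κ : Fin d) (x : Fin d → ℤ) :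
    mapDual (k2 𝕜) (Gf (upF W) B B' κ x) = Gf (upF W) B 0 κ x :=
  TrivSqZeroExt.ext (by simp [Gf, k2_Ebg]) (by simp [Gf, k2_Ebg])

/-- [folklore] … backward letter. -/
theorem k2_Gb_upF (W B B' : Form1 d 𝔸) (κ : Fin d) (x : Fin d → ℤ) :
    mapDual (k2 𝕜) (Gb (upF W) B B' κ x) = Gb (upF W) B 0 κ x :=
  TrivSqZeroExt.ext (by simp [Gb, k2_Ebi]) (by simp [Gb, k2_Ebi])

/-- [folklore] `k2` on the pure-background forward letter kills `B′`. -/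
theorem k2_Gf_zero (B B' : Form1 d 𝔸) (κ : Fin d) (x : Fin d → ℤ) :
    mapDual (k2 𝕜) (Gf 0 B B' κ x) = Gf 0 B 0 κ x :=
  TrivSqZeroExt.ext (by simp [Gf, k2_Ebg]) (by simp [Gf, k2_Ebg])

/-- [folklore] … backward letter. -/
theorem k2_Gb_zero (B B' : Form1 d 𝔸) (κ : Fin d) (x : Fin d → ℤ) :
    mapDual (k2 𝕜) (Gb 0 B B' κ x) = Gb 0 B 0 κ x :=
  TrivSqZeroExt.ext (by simp [Gb, k2_Ebi]) (by simp [Gb, k2_Ebi])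

/-- [folklore] Killing `τ₁` on the rooted averaging (scalar fluctuation) kills `B`. -/
theorem k1_PhiRAt_upF (ρ : Fin d → ℤ) (W B B' : Form1 d 𝔸) (L : ℕ) (μ : Fin d) (y : Fin d → ℤ) :
    mapDual (k1 𝕜) (PhiRAt 𝕜 ρ (upF W) B B' L μ y) = PhiRAt 𝕜 ρ (upF W) 0 B' L μ y := by
  rw [PhiRAt, PhiRAt, map_PhiGAt]; simp only [k1_Gf_upF, k1_Gb_upF]; try rfl

/-- [folklore] Killing `τ₁` on the pure-background rooted averaging kills `B`. -/
theorem k1_PhiRAt_zero (ρ : Fin d → ℤ) (B B' : Form1 d 𝔸) (L : ℕ) (μ : Fin d) (y : Fin d → ℤ) :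
    mapDual (k1 𝕜) (PhiRAt 𝕜 ρ 0 B B' L μ y) = PhiRAt 𝕜 ρ 0 0 B' L μ y := by
  rw [PhiRAt, PhiRAt, map_PhiGAt]; simp only [k1_Gf_zero, k1_Gb_zero]; try rfl

/-- [folklore] Killing `τ₂` on the rooted averaging (scalar fluctuation) kills `B′`. -/
theorem k2_PhiRAt_upF (ρ : Fin d → ℤ) (W B B' : Form1 d 𝔸) (L : ℕ) (μ : Fin d) (y : Fin d → ℤ) :
    mapDual (k2 𝕜) (PhiRAt 𝕜 ρ (upF W) B B' L μ y) = PhiRAt 𝕜 ρ (upF W) B 0 L μ y := by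
  rw [PhiRAt, PhiRAt, map_PhiGAt]; simp only [k2_Gf_upF, k2_Gb_upF]; try rfl

/-- [folklore] Killing `τ₂` on the pure-background rooted averaging kills `B′`. -/
theorem k2_PhiRAt_zero (ρ : Fin d → ℤ) (B B' : Form1 d 𝔸) (L : ℕ) (μ : Fin d) (y : Fin d → ℤ) :
    mapDual (k2 𝕜) (PhiRAt 𝕜 ρ 0 B B' L μ y) = PhiRAt 𝕜 ρ 0 B 0 L μ y := by
  rw [PhiRAt, PhiRAt, map_PhiGAt]; simp only [k2_Gf_zero, k2_Gb_zero]; try rfl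

/-- [folklore] **The `τ₁τ₂`-component of the rooted jet VANISHES without the first background.** -/
theorem c11_QjetAt_B_zero (ρ : Fin d → ℤ) (W B' : Form1 d 𝔸) (L : ℕ) (μ : Fin d) (y : Fin d → ℤ) :
    c11 (QjetAt 𝕜 ρ (upF W) 0 B' L μ y) = 0 := by
  have e := congrArg (fun Z : Rho 𝔸 => c11 Z.snd)
    (map_logT (mapDual (k1 𝕜)) (PhiRAt 𝕜 ρ (upF W) 0 B' L μ y * invT (PhiRAt 𝕜 ρ 0 0 B' L μ y)))
  simp only [map_mul, map_invT, k1_PhiRAt_upF, k1_PhiRAt_zero, snd_mapDual, c11_k1] at e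
  rw [QjetAt]; exact e.symm

/-- [folklore] **The `τ₁τ₂`-component of the rooted jet VANISHES without the second background.** -/
theorem c11_QjetAt_B'_zero (ρ : Fin d → ℤ) (W B : Form1 d 𝔸) (L : ℕ) (μ : Fin d) (y : Fin d → ℤ) :
    c11 (QjetAt 𝕜 ρ (upF W) B 0 L μ y) = 0 := by
  have e := congrArg (fun Z : Rho 𝔸 => c11 Z.snd)
    (map_logT (mapDual (k2 𝕜)) (PhiRAt 𝕜 ρ (upF W) B 0 L μ y * invT (PhiRAt 𝕜 ρ 0 B 0 L μ y)))
  simp only [map_mul, map_invT, k2_PhiRAt_upF, k2_PhiRAt_zero, snd_mapDual, c11_k2] at e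
  rw [QjetAt]; exact e.symm

/-- [folklore] `T2At` vanishes without fluctuation. -/
theorem T2At_ω_zero (ρ : Fin d → ℤ) (B B' : Form1 d 𝔸) (L : ℕ) (μ : Fin d) (y : Fin d → ℤ) :
    T2At 𝕜 ρ 0 B B' L μ y = 0 := by
  rw [T2At, QjetAt_ω_zero, QjetAt_ω_zero, c11_zero, add_zero]

/-- [folklore] `T2At` (scalar fluctuation) vanishes without the first background. -/
theorem T2At_B_zero (ρ : Fin d → ℤ) (W B' : Form1 d 𝔸) (L : ℕ) (μ : Fin d) (y : Fin d → ℤ) :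
    T2At 𝕜 ρ (upF W) 0 B' L μ y = 0 := by
  rw [T2At, c11_QjetAt_B_zero, c11_QjetAt_B'_zero, add_zero]

/-- [folklore] `T2At` (scalar fluctuation) vanishes without the second background. -/
theorem T2At_B'_zero (ρ : Fin d → ℤ) (W B : Form1 d 𝔸) (L : ℕ) (μ : Fin d) (y : Fin d → ℤ) :
    T2At 𝕜 ρ (upF W) B 0 L μ y = 0 := by
  rw [T2At, c11_QjetAt_B'_zero, c11_QjetAt_B_zero, add_zero]

/-- [folklore] CONGRUENCE of `T2At` for a root offset in the box. -/
theorem T2At_congr_near {r : Fin d → ℕ} {L : ℕ} (hr : r ∈ box d L) {ω ω' : Form1 d (Tau 𝔸)}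
    {B B₁ B' B₁' : Form1 d 𝔸} (μ : Fin d) (y : Fin d → ℤ) (hω : ∀ κ x, Near L y x → ω κ x = ω' κ x)
    (hB : ∀ κ x, Near L y x → B κ x = B₁ κ x) (hB' : ∀ κ x, Near L y x → B' κ x = B₁' κ x) :
    T2At 𝕜 (toSite r) ω B B' L μ y = T2At 𝕜 (toSite r) ω' B₁ B₁' L μ y := by
  rw [T2At, T2At, QjetAt_congr_near 𝕜 hr μ y hω hB hB', QjetAt_congr_near 𝕜 hr μ y hω hB' hB]

/-- [folklore] The mixed jet vanishes when the first fluctuation vanishes on the support box. -/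
theorem MjetAt_W_off {r : Fin d → ℕ} {L : ℕ} (hr : r ∈ box d L) {μ : Fin d} {y : Fin d → ℤ} {W : Form1 d 𝔸}
    (hW : ∀ κ x, Near L y x → W κ x = 0) (V B : Form1 d 𝔸) : MjetAt 𝕜 (toSite r) W V B L μ y = 0 :=
  (MjetAt_congr_near 𝕜 hr μ y (W' := 0) hW (fun _ _ _ => rfl) (fun _ _ _ => rfl)).trans
    (MjetAt_W_zero 𝕜 _ V B L μ y)

/-- [folklore] The mixed jet vanishes when the second fluctuation vanishes on the support box. -/
theorem MjetAt_V_off {r : Fin d → ℕ} {L : ℕ} (hr : r ∈ box d L) {μ : Fin d} {y : Fin d → ℤ} (W : Form1 d 𝔸)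
    {V : Form1 d 𝔸} (hV : ∀ κ x, Near L y x → V κ x = 0) (B : Form1 d 𝔸) :
    MjetAt 𝕜 (toSite r) W V B L μ y = 0 :=
  (MjetAt_congr_near 𝕜 hr μ y (V' := 0) (fun _ _ _ => rfl) hV (fun _ _ _ => rfl)).trans
    (MjetAt_V_zero 𝕜 _ W B L μ y)

/-- [folklore] The mixed jet vanishes when the background vanishes on the support box. -/
theorem MjetAt_B_off {r : Fin d → ℕ} {L : ℕ} (hr : r ∈ box d L) {μ : Fin d} {y : Fin d → ℤ} (W V : Form1 d 𝔸)
    {B : Form1 d 𝔸} (hB : ∀ κ x, Near L y x → B κ x = 0) : MjetAt 𝕜 (toSite r) W V B L μ y = 0 :=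
  (MjetAt_congr_near 𝕜 hr μ y (B' := 0) (fun _ _ _ => rfl) (fun _ _ _ => rfl) hB).trans
    (MjetAt_B_zero 𝕜 _ W V L μ y)

omit [Algebra 𝕜 𝔸] in
/-- [folklore] `ι 0 = 0`. -/
@[simp] theorem ι_zero : (ι (0 : 𝔸) : Tau 𝔸) = 0 := rfl

/-- [folklore] `T2At` vanishes when the (scalar) fluctuation vanishes on the support box. -/
theorem T2At_W_off {r : Fin d → ℕ} {L : ℕ} (hr : r ∈ box d L) {μ : Fin d} {y : Fin d → ℤ} {W : Form1 d 𝔸}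
    (hW : ∀ κ x, Near L y x → W κ x = 0) (B B' : Form1 d 𝔸) : T2At 𝕜 (toSite r) (upF W) B B' L μ y = 0 :=
  (T2At_congr_near 𝕜 hr μ y (ω' := 0) (fun κ x hx => by simp [hW κ x hx]) (fun _ _ _ => rfl)
    (fun _ _ _ => rfl)).trans (T2At_ω_zero 𝕜 _ B B' L μ y)

/-- [folklore] `T2At` vanishes when the first background vanishes on the support box. -/
theorem T2At_B_off {r : Fin d → ℕ} {L : ℕ} (hr : r ∈ box d L) {μ : Fin d} {y : Fin d → ℤ} (W : Form1 d 𝔸)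
    {B : Form1 d 𝔸} (hB : ∀ κ x, Near L y x → B κ x = 0) (B' : Form1 d 𝔸) :
    T2At 𝕜 (toSite r) (upF W) B B' L μ y = 0 :=
  (T2At_congr_near 𝕜 hr μ y (B₁ := 0) (fun _ _ _ => rfl) hB (fun _ _ _ => rfl)).trans
    (T2At_B_zero 𝕜 _ W B' L μ y)

/-- [folklore] `T2At` vanishes when the second background vanishes on the support box. -/
theorem T2At_B'_off {r : Fin d → ℕ} {L : ℕ} (hr : r ∈ box d L) {μ : Fin d} {y : Fin d → ℤ} (W B : Form1 d 𝔸)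
    {B' : Form1 d 𝔸} (hB' : ∀ κ x, Near L y x → B' κ x = 0) : T2At 𝕜 (toSite r) (upF W) B B' L μ y = 0 :=
  (T2At_congr_near 𝕜 hr μ y (B₁' := 0) (fun _ _ _ => rfl) (fun _ _ _ => rfl) hB').trans
    (T2At_B'_zero 𝕜 _ W B L μ y)

end QjetVanishing

/-! ### Support and covariance of the tables -/

/-- [folklore] A single-bond form based OFF the support box vanishes ON it. -/
theorem single_off {𝔸 : Type*} [Zero 𝔸] {L : ℕ} {y : Fin d → ℤ} {f : Bond d} (h : ¬ Near L y f.2) (w : 𝔸) :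
    ∀ κ x, Near L y x → single f w κ x = 0 := by
  intro κ x hx
  rw [single_apply, if_neg]
  rintro rfl
  exact h hx

variable {r : Fin d → ℕ} {L : ℕ}

/-- [folklore] `a(f,g,f′) = 0` unless `f` is based in the support box. -/
theorem aTab_eq_zero₁ (hr : r ∈ box d L) (μ : Fin d) (y : Fin d → ℤ) {f : Bond d} (h : ¬ Near L y f.2)
    (g f' : Bond d) : aTab (toSite r) L μ y f g f' = 0 := by
  rw [aTab, MjetAt_W_off ℚ hr (single_off h _)]; rfl

/-- [folklore] `a(f,g,f′) = 0` unless `g` is based in the support box. -/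
theorem aTab_eq_zero₂ (hr : r ∈ box d L) (μ : Fin d) (y : Fin d → ℤ) (f : Bond d) {g : Bond d}
    (h : ¬ Near L y g.2) (f' : Bond d) : aTab (toSite r) L μ y f g f' = 0 := by
  rw [aTab, MjetAt_B_off ℚ hr _ _ (single_off h _)]; rfl

/-- [folklore] `a(f,g,f′) = 0` unless `f′` is based in the support box. -/
theorem aTab_eq_zero₃ (hr : r ∈ box d L) (μ : Fin d) (y : Fin d → ℤ) (f g : Bond d) {f' : Bond d}
    (h : ¬ Near L y f'.2) : aTab (toSite r) L μ y f g f' = 0 := by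
  rw [aTab, MjetAt_V_off ℚ hr _ (single_off h _)]; rfl

/-- [folklore] `a′(f,g,f′) = 0` unless `f` is based in the support box. -/
theorem apTab_eq_zero₁ (hr : r ∈ box d L) (μ : Fin d) (y : Fin d → ℤ) {f : Bond d} (h : ¬ Near L y f.2)
    (g f' : Bond d) : apTab (toSite r) L μ y f g f' = 0 := by
  rw [apTab, MjetAt_W_off ℚ hr (single_off h _)]; rfl

/-- [folklore] `a′(f,g,f′) = 0` unless `g` is based in the support box. -/
theorem apTab_eq_zero₂ (hr : r ∈ box d L) (μ : Fin d) (y : Fin d → ℤ) (f : Bond d) {g : Bond d}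
    (h : ¬ Near L y g.2) (f' : Bond d) : apTab (toSite r) L μ y f g f' = 0 := by
  rw [apTab, MjetAt_B_off ℚ hr _ _ (single_off h _)]; rfl

/-- [folklore] `a′(f,g,f′) = 0` unless `f′` is based in the support box. -/
theorem apTab_eq_zero₃ (hr : r ∈ box d L) (μ : Fin d) (y : Fin d → ℤ) (f g : Bond d) {f' : Bond d}
    (h : ¬ Near L y f'.2) : apTab (toSite r) L μ y f g f' = 0 := by
  rw [apTab, MjetAt_V_off ℚ hr _ (single_off h _)]; rfl

/-- [folklore] `t(f,f′;g) = 0` unless `f` is based in the support box. -/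
theorem tTab_eq_zero₁ (hr : r ∈ box d L) (μ : Fin d) (y : Fin d → ℤ) {f : Bond d} (h : ¬ Near L y f.2)
    (f' g : Bond d) : tTab (toSite r) L μ y f f' g = 0 := by
  rw [tTab, aTab_eq_zero₁ hr μ y h, apTab_eq_zero₁ hr μ y h, aTab_eq_zero₃ hr μ y _ _ h]; ring

/-- [folklore] `t(f,f′;g) = 0` unless `f′` is based in the support box. -/
theorem tTab_eq_zero₂ (hr : r ∈ box d L) (μ : Fin d) (y : Fin d → ℤ) (f : Bond d) {f' : Bond d}
    (h : ¬ Near L y f'.2) (g : Bond d) : tTab (toSite r) L μ y f f' g = 0 := by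
  rw [tTab, aTab_eq_zero₃ hr μ y _ _ h, apTab_eq_zero₃ hr μ y _ _ h, aTab_eq_zero₁ hr μ y h]; ring

/-- [folklore] `t(f,f′;g) = 0` unless `g` is based in the support box. -/
theorem tTab_eq_zero₃ (hr : r ∈ box d L) (μ : Fin d) (y : Fin d → ℤ) (f f' : Bond d) {g : Bond d}
    (h : ¬ Near L y g.2) : tTab (toSite r) L μ y f f' g = 0 := by
  rw [tTab, aTab_eq_zero₂ hr μ y _ h, apTab_eq_zero₂ hr μ y _ h, aTab_eq_zero₂ hr μ y _ h]; ring

/-- [folklore] `s(f;g,h) = 0` unless `f` is based in the support box. -/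
theorem vh2Tab_eq_zero₁ (hr : r ∈ box d L) (μ : Fin d) (y : Fin d → ℤ) {f : Bond d} (h : ¬ Near L y f.2)
    (g h' : Bond d) : vh2Tab (toSite r) L μ y f g h' = 0 := by
  rw [vh2Tab, T2At_W_off ℚ hr (single_off h _)]; rfl

/-- [folklore] `s(f;g,h) = 0` unless `g` is based in the support box. -/
theorem vh2Tab_eq_zero₂ (hr : r ∈ box d L) (μ : Fin d) (y : Fin d → ℤ) (f : Bond d) {g : Bond d}
    (h : ¬ Near L y g.2) (h' : Bond d) : vh2Tab (toSite r) L μ y f g h' = 0 := by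
  rw [vh2Tab, T2At_B_off ℚ hr _ (single_off h _)]; rfl

/-- [folklore] `s(f;g,h) = 0` unless `h` is based in the support box. -/
theorem vh2Tab_eq_zero₃ (hr : r ∈ box d L) (μ : Fin d) (y : Fin d → ℤ) (f g : Bond d) {h' : Bond d}
    (h : ¬ Near L y h'.2) : vh2Tab (toSite r) L μ y f g h' = 0 := by
  rw [vh2Tab, T2At_B'_off ℚ hr _ _ (single_off h _)]; rfl

/-- [folklore] `shift` commutes with `upF`. -/
theorem shift_upF {𝔸 : Type*} [Ring 𝔸] (v : Fin d → ℤ) (W : Form1 d 𝔸) : shift v (upF W) = upF (shift v W) :=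
  rfl

/-- [folklore] BLOCK COVARIANCE of `a`. -/
theorem aTab_add (ρ : Fin d → ℤ) (L : ℕ) (μ : Fin d) (y t : Fin d → ℤ) (f g f' : Bond d) :
    aTab ρ L μ (y + t) (f.sh ((L : ℤ) • t)) (g.sh ((L : ℤ) • t)) (f'.sh ((L : ℤ) • t)) = aTab ρ L μ y f g f' := by
  rw [aTab, aTab, MjetAt_add, shift_single, shift_single, shift_single]

/-- [folklore] BLOCK COVARIANCE of `a′`. -/
theorem apTab_add (ρ : Fin d → ℤ) (L : ℕ) (μ : Fin d) (y t : Fin d → ℤ) (f g f' : Bond d) :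
    apTab ρ L μ (y + t) (f.sh ((L : ℤ) • t)) (g.sh ((L : ℤ) • t)) (f'.sh ((L : ℤ) • t)) = apTab ρ L μ y f g f' := by
  rw [apTab, apTab, MjetAt_add, shift_single, shift_single, shift_single]

/-- [folklore] BLOCK COVARIANCE of `t`. -/
theorem tTab_add (ρ : Fin d → ℤ) (L : ℕ) (μ : Fin d) (y t : Fin d → ℤ) (f f' g : Bond d) :
    tTab ρ L μ (y + t) (f.sh ((L : ℤ) • t)) (f'.sh ((L : ℤ) • t)) (g.sh ((L : ℤ) • t)) = tTab ρ L μ y f f' g := by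
  rw [tTab, tTab, aTab_add, apTab_add, aTab_add]

/-- [folklore] BLOCK COVARIANCE of `s`. -/
theorem vh2Tab_add (ρ : Fin d → ℤ) (L : ℕ) (μ : Fin d) (y t : Fin d → ℤ) (f g h : Bond d) :
    vh2Tab ρ L μ (y + t) (f.sh ((L : ℤ) • t)) (g.sh ((L : ℤ) • t)) (h.sh ((L : ℤ) • t)) = vh2Tab ρ L μ y f g h := by
  rw [vh2Tab, vh2Tab, T2At_add, shift_upF, shift_single, shift_single, shift_single]

/-! ### Finiteness: the reference-block absolute sums dominate every entry -/

/-- [folklore] The base points of node 7a's support box of the block `y = 0`, as a `Finset`. -/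
def nearSet (d L : ℕ) : Finset (Fin d → ℤ) := Fintype.piFinset fun _ : Fin d => Finset.Icc (0 : ℤ) (2 * (L : ℤ) - 1)

/-- [folklore] Membership in `nearSet`. -/
theorem mem_nearSet {x : Fin d → ℤ} : x ∈ nearSet d L ↔ Near L 0 x := by
  simp only [nearSet, Fintype.mem_piFinset, Finset.mem_Icc, Near, Pi.zero_apply, mul_zero, zero_add]

/-- [folklore] The bonds based in the support box of the block `0`, as a `Finset`. -/
def bondSet (d L : ℕ) : Finset (Bond d) := Finset.univ ×ˢ nearSet d L

/-- [folklore] Membership in `bondSet`. -/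
theorem mem_bondSet {f : Bond d} : f ∈ bondSet d L ↔ Near L 0 f.2 := by
  simp [bondSet, mem_nearSet]

/-- [folklore] The support box of the block `y` is the translate of that of the block `0`. -/
theorem near_zero_iff {y x : Fin d → ℤ} : Near L 0 (x + -((L : ℤ) • y)) ↔ Near L y x := by
  simp only [Near, Pi.add_apply, Pi.neg_apply, Pi.smul_apply, Pi.zero_apply, smul_eq_mul, mul_zero, zero_add]
  exact forall_congr' fun i => by constructor <;> rintro ⟨h1, h2⟩ <;> constructor <;> linarith

/-- [folklore] Shifting back and forth. -/
@[simp] theorem sh_neg_sh (f : Bond d) (v : Fin d → ℤ) : (f.sh (-v)).sh v = f :=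
  Prod.ext rfl (by simp [Bond.sh])

/-- [folklore] `t` at the block `y` is `t` at the block `0` on the back-shifted bonds. -/
theorem tTab_eq_zero_block (ρ : Fin d → ℤ) (L : ℕ) (μ : Fin d) (y : Fin d → ℤ) (f f' g : Bond d) :
    tTab ρ L μ y f f' g
      = tTab ρ L μ 0 (f.sh (-((L : ℤ) • y))) (f'.sh (-((L : ℤ) • y))) (g.sh (-((L : ℤ) • y))) := by
  have h := tTab_add ρ L μ 0 y (f.sh (-((L : ℤ) • y))) (f'.sh (-((L : ℤ) • y))) (g.sh (-((L : ℤ) • y)))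
  rw [zero_add, sh_neg_sh, sh_neg_sh, sh_neg_sh] at h
  exact h

/-- [folklore] `s` at the block `y` is `s` at the block `0` on the back-shifted bonds. -/
theorem vh2Tab_eq_zero_block (ρ : Fin d → ℤ) (L : ℕ) (μ : Fin d) (y : Fin d → ℤ) (f g h : Bond d) :
    vh2Tab ρ L μ y f g h
      = vh2Tab ρ L μ 0 (f.sh (-((L : ℤ) • y))) (g.sh (-((L : ℤ) • y))) (h.sh (-((L : ℤ) • y))) := by
  have e := vh2Tab_add ρ L μ 0 y (f.sh (-((L : ℤ) • y))) (g.sh (-((L : ℤ) • y))) (h.sh (-((L : ℤ) • y)))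
  rw [zero_add, sh_neg_sh, sh_neg_sh, sh_neg_sh] at e
  exact e

/-- [folklore] THE REFERENCE-BLOCK ABSOLUTE SUM of the mixed table: `Σ_μ Σ_{f,f′,g ∈ box bonds} |t^ρ_{(μ,0)}(f,f′;g)|`
(an honest, finite constant; no closed form is claimed). -/
def mixAbs (ρ : Fin d → ℤ) (L : ℕ) : ℝ :=
  ∑ μ : Fin d, ∑ p ∈ (bondSet d L ×ˢ bondSet d L) ×ˢ bondSet d L, |(tTab ρ L μ 0 p.1.1 p.1.2 p.2 : ℝ)|

/-- [folklore] THE REFERENCE-BLOCK ABSOLUTE SUM of the `T₂` table: `Σ_μ Σ_{f,g,h ∈ box bonds} |s^ρ_{(μ,0)}(f;g,h)|`. -/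
def vh2Abs (ρ : Fin d → ℤ) (L : ℕ) : ℝ :=
  ∑ μ : Fin d, ∑ p ∈ (bondSet d L ×ˢ bondSet d L) ×ˢ bondSet d L, |(vh2Tab ρ L μ 0 p.1.1 p.1.2 p.2 : ℝ)|

/-- [folklore] `0 ≤ mixAbs`. -/
theorem mixAbs_nonneg (ρ : Fin d → ℤ) (L : ℕ) : 0 ≤ mixAbs ρ L :=
  Finset.sum_nonneg fun _ _ => Finset.sum_nonneg fun _ _ => abs_nonneg _

/-- [folklore] `0 ≤ vh2Abs`. -/
theorem vh2Abs_nonneg (ρ : Fin d → ℤ) (L : ℕ) : 0 ≤ vh2Abs ρ L :=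
  Finset.sum_nonneg fun _ _ => Finset.sum_nonneg fun _ _ => abs_nonneg _

/-- [folklore] Every reference-block entry is dominated by `mixAbs`. -/
theorem le_mixAbs (ρ : Fin d → ℤ) (L : ℕ) (μ : Fin d) {p : (Bond d × Bond d) × Bond d}
    (hp : p ∈ (bondSet d L ×ˢ bondSet d L) ×ˢ bondSet d L) :
    |(tTab ρ L μ 0 p.1.1 p.1.2 p.2 : ℝ)| ≤ mixAbs ρ L := by
  have h1 : |(tTab ρ L μ 0 p.1.1 p.1.2 p.2 : ℝ)|
      ≤ ∑ q ∈ (bondSet d L ×ˢ bondSet d L) ×ˢ bondSet d L, |(tTab ρ L μ 0 q.1.1 q.1.2 q.2 : ℝ)| :=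
    Finset.single_le_sum (f := fun q : (Bond d × Bond d) × Bond d => |(tTab ρ L μ 0 q.1.1 q.1.2 q.2 : ℝ)|)
      (fun _ _ => abs_nonneg _) hp
  refine h1.trans ?_
  rw [mixAbs]
  exact Finset.single_le_sum (f := fun ν : Fin d => ∑ q ∈ (bondSet d L ×ˢ bondSet d L) ×ˢ bondSet d L,
    |(tTab ρ L ν 0 q.1.1 q.1.2 q.2 : ℝ)|) (fun _ _ => Finset.sum_nonneg fun _ _ => abs_nonneg _) (Finset.mem_univ μ)

/-- [folklore] Every reference-block entry is dominated by `vh2Abs`. -/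
theorem le_vh2Abs (ρ : Fin d → ℤ) (L : ℕ) (μ : Fin d) {p : (Bond d × Bond d) × Bond d}
    (hp : p ∈ (bondSet d L ×ˢ bondSet d L) ×ˢ bondSet d L) :
    |(vh2Tab ρ L μ 0 p.1.1 p.1.2 p.2 : ℝ)| ≤ vh2Abs ρ L := by
  have h1 : |(vh2Tab ρ L μ 0 p.1.1 p.1.2 p.2 : ℝ)|
      ≤ ∑ q ∈ (bondSet d L ×ˢ bondSet d L) ×ˢ bondSet d L, |(vh2Tab ρ L μ 0 q.1.1 q.1.2 q.2 : ℝ)| :=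
    Finset.single_le_sum (f := fun q : (Bond d × Bond d) × Bond d => |(vh2Tab ρ L μ 0 q.1.1 q.1.2 q.2 : ℝ)|)
      (fun _ _ => abs_nonneg _) hp
  refine h1.trans ?_
  rw [vh2Abs]
  exact Finset.single_le_sum (f := fun ν : Fin d => ∑ q ∈ (bondSet d L ×ˢ bondSet d L) ×ˢ bondSet d L,
    |(vh2Tab ρ L ν 0 q.1.1 q.1.2 q.2 : ℝ)|) (fun _ _ => Finset.sum_nonneg fun _ _ => abs_nonneg _) (Finset.mem_univ μ)

/-- [folklore] **FINITE RANGE + UNIFORM BOUND of the mixed table** (root offset in the box). -/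
theorem abs_tTab_le (hr : r ∈ box d L) (μ : Fin d) (y : Fin d → ℤ) (f f' g : Bond d) :
    |(tTab (toSite r) L μ y f f' g : ℝ)| ≤ mixAbs (toSite r) L := by
  by_cases hf : Near L y f.2
  · by_cases hf' : Near L y f'.2
    · by_cases hg : Near L y g.2
      · have hmem : ((f.sh (-((L : ℤ) • y)), f'.sh (-((L : ℤ) • y))), g.sh (-((L : ℤ) • y)))
            ∈ (bondSet d L ×ˢ bondSet d L) ×ˢ bondSet d L := by
          simp only [Finset.mem_product, mem_bondSet, Bond.sh_snd]
          exact ⟨⟨near_zero_iff.2 hf, near_zero_iff.2 hf'⟩, near_zero_iff.2 hg⟩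
        have k := le_mixAbs (toSite r) L μ hmem
        rw [← tTab_eq_zero_block] at k
        exact k
      · rw [tTab_eq_zero₃ hr μ y _ _ hg, Rat.cast_zero, abs_zero]; exact mixAbs_nonneg _ _
    · rw [tTab_eq_zero₂ hr μ y _ hf', Rat.cast_zero, abs_zero]; exact mixAbs_nonneg _ _
  · rw [tTab_eq_zero₁ hr μ y hf, Rat.cast_zero, abs_zero]; exact mixAbs_nonneg _ _

/-- [folklore] **FINITE RANGE + UNIFORM BOUND of the `T₂` table** (root offset in the box). -/
theorem abs_vh2Tab_le (hr : r ∈ box d L) (μ : Fin d) (y : Fin d → ℤ) (f g h : Bond d) :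
    |(vh2Tab (toSite r) L μ y f g h : ℝ)| ≤ vh2Abs (toSite r) L := by
  by_cases hf : Near L y f.2
  · by_cases hg : Near L y g.2
    · by_cases hh : Near L y h.2
      · have hmem : ((f.sh (-((L : ℤ) • y)), g.sh (-((L : ℤ) • y))), h.sh (-((L : ℤ) • y)))
            ∈ (bondSet d L ×ˢ bondSet d L) ×ˢ bondSet d L := by
          simp only [Finset.mem_product, mem_bondSet, Bond.sh_snd]
          exact ⟨⟨near_zero_iff.2 hf, near_zero_iff.2 hg⟩, near_zero_iff.2 hh⟩
        have k := le_vh2Abs (toSite r) L μ hmem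
        rw [← vh2Tab_eq_zero_block] at k
        exact k
      · rw [vh2Tab_eq_zero₃ hr μ y _ _ hh, Rat.cast_zero, abs_zero]; exact vh2Abs_nonneg _ _
    · rw [vh2Tab_eq_zero₂ hr μ y _ hg, Rat.cast_zero, abs_zero]; exact vh2Abs_nonneg _ _
  · rw [vh2Tab_eq_zero₁ hr μ y hf, Rat.cast_zero, abs_zero]; exact vh2Abs_nonneg _ _

end Structure

/-! ## §7 The packed kernels `mixFFAt` (Q-C1) and `vh₂SAt` (Q-C3) for the background-field route -/

section Packed

open ExpKernelCalculus (MKer BiLoc shiftK)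
open OneStepResolventKernel (Fib LocStencil)
open B12Sec2to5 (l1 l1_nonneg)

variable {d : ℕ}

/-- [folklore] THE REAL MIXED KERNEL `t^ρ_b(f, f′; g)` (background bond `g` FIRST, then the ordered fluctuation pair). -/
def mixKerAt (ρ : Fin d → ℤ) (L : ℕ) (μ : Fin d) (y : Fin d → ℤ) (g f f' : Bond d) : ℝ :=
  (tTab ρ L μ y f f' g : ℝ)

/-- [folklore] THE REAL `T₂` BORDER KERNEL `s^ρ_b(f; g, h)` (fluctuation `f`, backgrounds `g`, `h`). -/
def vh2KerAt (ρ : Fin d → ℤ) (L : ℕ) (μ : Fin d) (y : Fin d → ℤ) (f g h : Bond d) : ℝ :=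
  (vh2Tab ρ L μ y f g h : ℝ)

/-- [folklore] Block covariance of `mixKerAt`. -/
theorem mixKerAt_add (ρ : Fin d → ℤ) (L : ℕ) (μ : Fin d) (y t : Fin d → ℤ) (g f f' : Bond d) :
    mixKerAt ρ L μ (y + t) (g.sh ((L : ℤ) • t)) (f.sh ((L : ℤ) • t)) (f'.sh ((L : ℤ) • t)) = mixKerAt ρ L μ y g f f' := by
  rw [mixKerAt, mixKerAt, tTab_add]

/-- [folklore] Block covariance of `vh2KerAt`. -/
theorem vh2KerAt_add (ρ : Fin d → ℤ) (L : ℕ) (μ : Fin d) (y t : Fin d → ℤ) (f g h : Bond d) :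
    vh2KerAt ρ L μ (y + t) (f.sh ((L : ℤ) • t)) (g.sh ((L : ℤ) • t)) (h.sh ((L : ℤ) • t)) = vh2KerAt ρ L μ y f g h := by
  rw [vh2KerAt, vh2KerAt, vh2Tab_add]

/-- [folklore] **(Q-C1) THE MIXED TABLE PACKED ON THE FIELD–FIELD BLOCK** — an2's `M₂ κ u μ y` for `mixOfK`: entry
`((x, inl α), (x′, inl α′)) ↦ t^ρ_{(μ,y)}((α,x), (α′,x′); (κ,u))`, `0` elsewhere (same packing as node 7a's `hessFF`). -/
noncomputable def mixFFAt (ρ : Fin (d + 1) → ℤ) (L : ℕ) (κ : Fin (d + 1)) (u : Fin (d + 1) → ℤ) (μ : Fin (d + 1))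
    (y : Fin (d + 1) → ℤ) : MKer (d + 1) (Fib d) := fun x x' a b =>
  match a, b with
  | Sum.inl α, Sum.inl α' => mixKerAt ρ L μ y (κ, u) (α, x) (α', x')
  | _, _ => 0

/-- [folklore] The field–field entries of `mixFFAt`. -/
@[simp] theorem mixFFAt_inl_inl (ρ : Fin (d + 1) → ℤ) (L : ℕ) (κ : Fin (d + 1)) (u : Fin (d + 1) → ℤ)
    (μ : Fin (d + 1)) (y x x' : Fin (d + 1) → ℤ) (α α' : Fin (d + 1)) :
    mixFFAt ρ L κ u μ y x x' (Sum.inl α) (Sum.inl α') = mixKerAt ρ L μ y (κ, u) (α, x) (α', x') := rfl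

/-- [folklore] `mixFFAt` vanishes on `(inl, inr)`. -/
@[simp] theorem mixFFAt_inl_inr (ρ : Fin (d + 1) → ℤ) (L : ℕ) (κ : Fin (d + 1)) (u : Fin (d + 1) → ℤ)
    (μ : Fin (d + 1)) (y x x' : Fin (d + 1) → ℤ) (α μ' : Fin (d + 1)) :
    mixFFAt ρ L κ u μ y x x' (Sum.inl α) (Sum.inr μ') = 0 := rfl

/-- [folklore] `mixFFAt` vanishes on `(inr, ·)`. -/
@[simp] theorem mixFFAt_inr (ρ : Fin (d + 1) → ℤ) (L : ℕ) (κ : Fin (d + 1)) (u : Fin (d + 1) → ℤ)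
    (μ : Fin (d + 1)) (y x x' : Fin (d + 1) → ℤ) (μ' : Fin (d + 1)) (b : Fib d) :
    mixFFAt ρ L κ u μ y x x' (Sum.inr μ') b = 0 := by cases b <;> rfl

/-- [folklore] **(Q-C3) THE `T₂` BORDER TABLE PACKED LIKE `vhSAt`** — node 7a's packer applied to `s^ρ` with the FIRST
background bond `(κ, u)` closed over: `vh₂SAt ρ L κ u κ′ u′ x z (inl α) (inr μ) = s^ρ_{(μ, z/L)}((α,x); (κ,u), (κ′,u′))`
when `z ∈ L·ℤ^{d+1}` (else `0`), the symmetric twin on `(inr, inl)`, `0` on the diagonal blocks. -/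
noncomputable def vh₂SAt (ρ : Fin (d + 1) → ℤ) (L : ℕ) (κ : Fin (d + 1)) (u : Fin (d + 1) → ℤ) :
    Fin (d + 1) → (Fin (d + 1) → ℤ) → MKer (d + 1) (Fib d) :=
  packVH (fun μ y f f' => vh2KerAt ρ L μ y f (κ, u) f') L

/-- [folklore] Block-translation covariance of `mixFFAt` — the byte shape of an2's `hM₂`:
`M₂ κ (u + L·t) μ (y + t) = shiftK (−L·t) (M₂ κ u μ y)`. -/
theorem mixFFAt_translate (ρ : Fin (d + 1) → ℤ) (L : ℕ) (κ : Fin (d + 1)) (u : Fin (d + 1) → ℤ)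
    (μ : Fin (d + 1)) (y t : Fin (d + 1) → ℤ) :
    mixFFAt ρ L κ (u + (L : ℤ) • t) μ (y + t) = shiftK (-((L : ℤ) • t)) (mixFFAt ρ L κ u μ y) := by
  funext x x' a b
  simp only [shiftK]
  rcases a with α | ν
  · rcases b with α' | ν'
    · rw [mixFFAt_inl_inl, mixFFAt_inl_inl]
      have h := mixKerAt_add ρ L μ y t (κ, u) (α, x + -((L : ℤ) • t)) (α', x' + -((L : ℤ) • t))
      simp only [Bond.sh, neg_add_cancel_right] at h
      exact h
    · rw [mixFFAt_inl_inr, mixFFAt_inl_inr]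
  · rw [mixFFAt_inr, mixFFAt_inr]

/-- [folklore] Block-translation covariance of `vh₂SAt` — the byte shape of an2's `hS₂`:
`S₂ κ (u + L·t) κ′ (u′ + L·t) = shiftK (−L·t) (S₂ κ u κ′ u′)`. -/
theorem vh₂SAt_translate {L : ℕ} (hL : 1 ≤ L) (ρ : Fin (d + 1) → ℤ) (κ : Fin (d + 1)) (u : Fin (d + 1) → ℤ)
    (κ' : Fin (d + 1)) (u' t : Fin (d + 1) → ℤ) :
    vh₂SAt ρ L κ (u + (L : ℤ) • t) κ' (u' + (L : ℤ) • t) = shiftK (-((L : ℤ) • t)) (vh₂SAt ρ L κ u κ' u') := by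
  funext x z a b
  simp only [vh₂SAt, shiftK]
  have e1 : ∀ w : Fin (d + 1) → ℤ, w + -((L : ℤ) • t) = w + (L : ℤ) • (-t) := fun w => by rw [smul_neg]
  rcases a with α | μ <;> rcases b with α' | μ'
  · rw [packVH_inl_inl, packVH_inl_inl]
  · rw [packVH_inl_inr, packVH_inl_inr, e1, e1, off_add_smul, blk_add_smul hL]
    split_ifs with hz
    · have h := vh2KerAt_add ρ L μ' (blk L z + -t) t (α, x + (L : ℤ) • -t) (κ, u) (κ', u')
      rw [neg_add_cancel_right] at h
      rw [← h]
      congr 1; simp [Bond.sh, smul_neg]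
    · rfl
  · rw [packVH_inr_inl, packVH_inr_inl, e1, e1, off_add_smul, blk_add_smul hL]
    split_ifs with hx
    · have h := vh2KerAt_add ρ L μ (blk L x + -t) t (α', z + (L : ℤ) • -t) (κ, u) (κ', u')
      rw [neg_add_cancel_right] at h
      rw [← h]
      congr 1; simp [Bond.sh, smul_neg]
    · rfl
  · rw [packVH_inr_inr, packVH_inr_inr]

variable {r : Fin (d + 1) → ℕ} {L : ℕ}

/-- [folklore] **(Q-C1) `mixFFAt` IS BI-LOCALISED AT THE BACKGROUND BOND** with the block-distance prefactor — the
body of an2's `LocStencilFM L (mixFFAt ρ L) C δ`, for EVERY rate `δ ≥ 0`, with the honest constant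
`C = mixAbs ρ L · e^{6(d+1)Lδ}`. -/
theorem biLoc_mixFFAt (hL : 1 ≤ L) (hr : r ∈ box (d + 1) L) {δ : ℝ} (hδ : 0 ≤ δ) (κ : Fin (d + 1))
    (u : Fin (d + 1) → ℤ) (μ : Fin (d + 1)) (y : Fin (d + 1) → ℤ) :
    BiLoc (mixFFAt (toSite r) L κ u μ y) u u
      (mixAbs (toSite r) L * Real.exp (6 * ((d : ℝ) + 1) * L * δ)
        * Real.exp (-δ * l1 (u - (L : ℤ) • y))) δ := by
  intro x x' a b
  have hA := mixAbs_nonneg (toSite r) L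
  have hpos : 0 ≤ mixAbs (toSite r) L * Real.exp (6 * ((d : ℝ) + 1) * L * δ)
      * Real.exp (-δ * l1 (u - (L : ℤ) • y)) * Real.exp (-δ * (l1 (x - u) + l1 (x' - u))) :=
    mul_nonneg (mul_nonneg (mul_nonneg hA (Real.exp_pos _).le) (Real.exp_pos _).le) (Real.exp_pos _).le
  rcases a with α | ν
  · rcases b with α' | ν'
    · rw [mixFFAt_inl_inl, mixKerAt]
      by_cases hu : Near L y u
      · by_cases hx : Near L y x
        · by_cases hx' : Near L y x'
          · have d0 := l1_le_of_near hu (near_self hL y)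
            have d1 := l1_le_of_near hx hu
            have d2 := l1_le_of_near hx' hu
            have hb := abs_tTab_le hr μ y (α, x) (α', x') (κ, u)
            have h0 := l1_nonneg (u - (L : ℤ) • y)
            have h1' := l1_nonneg (x - u)
            have h2' := l1_nonneg (x' - u)
            have hsum : δ * l1 (u - (L : ℤ) • y) + δ * (l1 (x - u) + l1 (x' - u))
                ≤ 6 * ((d : ℝ) + 1) * L * δ := by nlinarith
            have h1 : 1 ≤ Real.exp (6 * ((d : ℝ) + 1) * L * δ) * Real.exp (-δ * l1 (u - (L : ℤ) • y))
                * Real.exp (-δ * (l1 (x - u) + l1 (x' - u))) := by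
              rw [← Real.exp_add, ← Real.exp_add]; exact Real.one_le_exp (by linarith)
            calc |(tTab (toSite r) L μ y (α, x) (α', x') (κ, u) : ℝ)| ≤ mixAbs (toSite r) L * 1 := by
                  rw [mul_one]; exact hb
              _ ≤ mixAbs (toSite r) L * (Real.exp (6 * ((d : ℝ) + 1) * L * δ)
                    * Real.exp (-δ * l1 (u - (L : ℤ) • y)) * Real.exp (-δ * (l1 (x - u) + l1 (x' - u)))) :=
                  mul_le_mul_of_nonneg_left h1 hA
              _ = _ := by ring
          · rw [tTab_eq_zero₂ hr μ y _ hx', Rat.cast_zero, abs_zero]; exact hpos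
        · rw [tTab_eq_zero₁ hr μ y hx, Rat.cast_zero, abs_zero]; exact hpos
      · rw [tTab_eq_zero₃ hr μ y _ _ hu, Rat.cast_zero, abs_zero]; exact hpos
    · rw [mixFFAt_inl_inr, abs_zero]; exact hpos
  · rw [mixFFAt_inr, abs_zero]; exact hpos

/-- [folklore] **(Q-C3) `vh₂SAt κ u κ′ u′` IS BI-LOCALISED AT THE FIRST BACKGROUND BOND** with the prefactor
`e^{−δ|u′ − u|₁}` — the body of an2's `LocStencil₂ S₂ C δ`, for EVERY rate `δ ≥ 0`, with the honest constant
`C = vh2Abs ρ L · e^{6(d+1)Lδ}`. -/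
theorem biLoc_vh₂SAt (hL : 1 ≤ L) (hr : r ∈ box (d + 1) L) {δ : ℝ} (hδ : 0 ≤ δ) (κ : Fin (d + 1))
    (u : Fin (d + 1) → ℤ) (κ' : Fin (d + 1)) (u' : Fin (d + 1) → ℤ) :
    BiLoc (vh₂SAt (toSite r) L κ u κ' u') u u
      (vh2Abs (toSite r) L * Real.exp (6 * ((d : ℝ) + 1) * L * δ) * Real.exp (-δ * l1 (u' - u))) δ := by
  intro x z a b
  have hA := vh2Abs_nonneg (toSite r) L
  have hpos : 0 ≤ vh2Abs (toSite r) L * Real.exp (6 * ((d : ℝ) + 1) * L * δ) * Real.exp (-δ * l1 (u' - u))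
      * Real.exp (-δ * (l1 (x - u) + l1 (z - u))) :=
    mul_nonneg (mul_nonneg (mul_nonneg hA (Real.exp_pos _).le) (Real.exp_pos _).le) (Real.exp_pos _).le
  -- the generic estimate for a supported entry
  have key : ∀ (x z : Fin (d + 1) → ℤ) (μ α : Fin (d + 1)), off L z = 0 →
      |vh2KerAt (toSite r) L μ (blk L z) (α, x) (κ, u) (κ', u')|
        ≤ vh2Abs (toSite r) L * Real.exp (6 * ((d : ℝ) + 1) * L * δ) * Real.exp (-δ * l1 (u' - u))
            * Real.exp (-δ * (l1 (x - u) + l1 (z - u))) := by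
    intro x z μ α hz
    have hpos' : 0 ≤ vh2Abs (toSite r) L * Real.exp (6 * ((d : ℝ) + 1) * L * δ) * Real.exp (-δ * l1 (u' - u))
        * Real.exp (-δ * (l1 (x - u) + l1 (z - u))) :=
      mul_nonneg (mul_nonneg (mul_nonneg hA (Real.exp_pos _).le) (Real.exp_pos _).le) (Real.exp_pos _).le
    rw [vh2KerAt]
    by_cases hx : Near L (blk L z) x
    · by_cases hu : Near L (blk L z) u
      · by_cases hu' : Near L (blk L z) u'
        · have hz' : Near L (blk L z) z := by
            have h0 := near_self hL (blk L z)
            rwa [← eq_smul_blk_of_off_eq_zero hL hz] at h0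
          have d1 := l1_le_of_near hx hu
          have d2 := l1_le_of_near hz' hu
          have d3 := l1_le_of_near hu' hu
          have e1 := l1_nonneg (x - u)
          have e2 := l1_nonneg (z - u)
          have e3 := l1_nonneg (u' - u)
          have hsum : δ * l1 (u' - u) + δ * (l1 (x - u) + l1 (z - u)) ≤ 6 * ((d : ℝ) + 1) * L * δ := by
            nlinarith
          have h1 : 1 ≤ Real.exp (6 * ((d : ℝ) + 1) * L * δ) * Real.exp (-δ * l1 (u' - u))
              * Real.exp (-δ * (l1 (x - u) + l1 (z - u))) := by
            rw [← Real.exp_add, ← Real.exp_add]; exact Real.one_le_exp (by linarith)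
          have hb := abs_vh2Tab_le hr μ (blk L z) (α, x) (κ, u) (κ', u')
          calc |(vh2Tab (toSite r) L μ (blk L z) (α, x) (κ, u) (κ', u') : ℝ)| ≤ vh2Abs (toSite r) L * 1 := by
                rw [mul_one]; exact hb
            _ ≤ vh2Abs (toSite r) L * (Real.exp (6 * ((d : ℝ) + 1) * L * δ) * Real.exp (-δ * l1 (u' - u))
                  * Real.exp (-δ * (l1 (x - u) + l1 (z - u)))) := mul_le_mul_of_nonneg_left h1 hA
            _ = _ := by ring
        · rw [vh2Tab_eq_zero₃ hr μ _ _ _ hu', Rat.cast_zero, abs_zero]; exact hpos'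
      · rw [vh2Tab_eq_zero₂ hr μ _ _ hu, Rat.cast_zero, abs_zero]; exact hpos'
    · rw [vh2Tab_eq_zero₁ hr μ _ hx, Rat.cast_zero, abs_zero]; exact hpos'
  rcases a with α | μ <;> rcases b with α' | μ'
  · rw [vh₂SAt, packVH_inl_inl, abs_zero]; exact hpos
  · rw [vh₂SAt, packVH_inl_inr]
    split_ifs with hz
    · exact key x z μ' α hz
    · rw [abs_zero]; exact hpos
  · rw [vh₂SAt, packVH_inr_inl]
    split_ifs with hx
    · rw [add_comm (l1 (x - u))]; exact key z x μ α' hx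
    · rw [abs_zero]; exact hpos
  · rw [vh₂SAt, packVH_inr_inr, abs_zero]; exact hpos

/-- [folklore] `vh₂SAt κ u κ′ u′` is symmetric (a packed stencil). -/
theorem vh₂SAt_symm (ρ : Fin (d + 1) → ℤ) (L : ℕ) (κ : Fin (d + 1)) (u : Fin (d + 1) → ℤ) (κ' : Fin (d + 1))
    (u' x z : Fin (d + 1) → ℤ) (a b : Fib d) :
    vh₂SAt ρ L κ u κ' u' x z a b = vh₂SAt ρ L κ u κ' u' z x b a := packVH_symm _ L κ' u' x z a b

end Packed

/-! ## §8 The `ρ = 0` bridges by name -/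

section Bridges

open ExpKernelCalculus (MKer BiLoc shiftK)
open OneStepResolventKernel (Fib LocStencil)
open B12Sec2to5 (l1 l1_nonneg)

variable {d : ℕ}

/-- [folklore] The zero root offset lies in the box as soon as `1 ≤ L`. -/
theorem zero_mem_box {n L : ℕ} (hL : 1 ≤ L) : (fun _ : Fin n => (0 : ℕ)) ∈ box n L := by
  simp only [AffineAveraging.box, Fintype.mem_piFinset, Finset.mem_range]; intro _; omega

/-- [folklore] (Q-C1) at the base root `ρ = 0`: `mixFF d L := mixFFAt 0 L`. -/
noncomputable abbrev mixFF (d L : ℕ) :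
    Fin (d + 1) → (Fin (d + 1) → ℤ) → Fin (d + 1) → (Fin (d + 1) → ℤ) → MKer (d + 1) (Fib d) :=
  mixFFAt (0 : Fin (d + 1) → ℤ) L

/-- [folklore] (Q-C3) at the base root `ρ = 0`: `vh₂S d L := vh₂SAt 0 L`. -/
noncomputable abbrev vh₂S (d L : ℕ) :
    Fin (d + 1) → (Fin (d + 1) → ℤ) → Fin (d + 1) → (Fin (d + 1) → ℤ) → MKer (d + 1) (Fib d) :=
  vh₂SAt (0 : Fin (d + 1) → ℤ) L

/-- [folklore] `biLoc_mixFFAt` at `ρ = 0`. -/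
theorem biLoc_mixFF {L : ℕ} (hL : 1 ≤ L) {δ : ℝ} (hδ : 0 ≤ δ) (κ : Fin (d + 1)) (u : Fin (d + 1) → ℤ)
    (μ : Fin (d + 1)) (y : Fin (d + 1) → ℤ) :
    BiLoc (mixFF d L κ u μ y) u u
      (mixAbs (0 : Fin (d + 1) → ℤ) L * Real.exp (6 * ((d : ℝ) + 1) * L * δ)
        * Real.exp (-δ * l1 (u - (L : ℤ) • y))) δ := by
  have h := biLoc_mixFFAt hL (zero_mem_box hL) hδ κ u μ y
  rwa [toSite_zero] at h

/-- [folklore] `mixFFAt_translate` at `ρ = 0` (an2's `hM₂`). -/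
theorem mixFF_translate (L : ℕ) (κ : Fin (d + 1)) (u : Fin (d + 1) → ℤ) (μ : Fin (d + 1))
    (y t : Fin (d + 1) → ℤ) :
    mixFF d L κ (u + (L : ℤ) • t) μ (y + t) = shiftK (-((L : ℤ) • t)) (mixFF d L κ u μ y) :=
  mixFFAt_translate 0 L κ u μ y t

/-- [folklore] `biLoc_vh₂SAt` at `ρ = 0`. -/
theorem biLoc_vh₂S {L : ℕ} (hL : 1 ≤ L) {δ : ℝ} (hδ : 0 ≤ δ) (κ : Fin (d + 1)) (u : Fin (d + 1) → ℤ)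
    (κ' : Fin (d + 1)) (u' : Fin (d + 1) → ℤ) :
    BiLoc (vh₂S d L κ u κ' u') u u
      (vh2Abs (0 : Fin (d + 1) → ℤ) L * Real.exp (6 * ((d : ℝ) + 1) * L * δ) * Real.exp (-δ * l1 (u' - u))) δ := by
  have h := biLoc_vh₂SAt hL (zero_mem_box hL) hδ κ u κ' u'
  rwa [toSite_zero] at h

/-- [folklore] `vh₂SAt_translate` at `ρ = 0` (an2's `hS₂`). -/
theorem vh₂S_translate {L : ℕ} (hL : 1 ≤ L) (κ : Fin (d + 1)) (u : Fin (d + 1) → ℤ) (κ' : Fin (d + 1))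
    (u' t : Fin (d + 1) → ℤ) :
    vh₂S d L κ (u + (L : ℤ) • t) κ' (u' + (L : ℤ) • t) = shiftK (-((L : ℤ) • t)) (vh₂S d L κ u κ' u') :=
  vh₂SAt_translate hL 0 κ u κ' u' t

end Bridges

end

end Literature.MathematicalPhysics.QuantumFieldTheory.Balaban1983to89.Beta.AveragingMixedJetTables
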